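import Literature.LinearAlgebra.TensorNetworks.QTTCirculantRankBounds
import Literature.LinearAlgebra.TensorNetworks.QTTLaplaceNeumannPeriodic
import Literature.LinearAlgebra.Matrix.MoorePenroseInverse

/-!
# Moore–Penrose inverses of difference matrices: the periodic and Neumann Laplacians and
# biharmonic operators in closed form (Plonka–Hoffmann–Weickert 2016, Theorems 2.1–2.3, 2.5–2.6)
# and the QTT ranks `≤ 4` of `Δ_P⁺` (Vysotsky–Rakhuba 2022, Proposition 5.2 / Corollary 5.2)

Sources.
* G. Plonka, S. Hoffmann, J. Weickert, *Pseudo-inverses of difference matrices and their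
  application to sparse signal approximation*, Linear Algebra Appl. 503 (2016) 26–47,
  arXiv:1504.04266 [PlonkaHoffmannWeickert2016] (held text `paper:arxiv-1504.04266`: §2,
  Theorem 2.1 p. 3, Theorems 2.2–2.3 p. 4, Theorem 2.5 p. 5, Theorem 2.6 p. 6).
* L. Vysotsky, M. Rakhuba, *Tensor rank bounds and explicit QTT representations for the inverses
  of circulant matrices*, Numer. Linear Algebra Appl. 30(3) (2023) e2461, arXiv:2205.04335
  [VysotskyRakhuba2022] (held text `paper:arxiv-2205.04335`: §5.3, Proposition 5.2 and
  Corollary 5.2, p. 13).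
Builds on `QTTCirculantRankBounds` (VR22 Theorem 3.1 / Corollary 3.2: QTT ranks of circulants with
monomial–exponential symbols, `rank_qttUnfolding_circulant_expPoly_le`,
`exists_qttMatrix_eq_circulant_expPoly`), on `QTTLaplace` / `QTTLaplaceNeumannPeriodic` (the
periodic and Neumann Laplacians `laplaceP`, `laplaceNN` = Kazeev–Khoromskij's `Δ_P`, `Δ_NN`,
eqs. (6), (4)) and on `Matrix.MoorePenroseInverse` (Penrose 1955: `pinv`,
`IsMoorePenroseInverse`, uniqueness `isMoorePenroseInverse_iff_eq_pinv`).  The companion file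
`BandCirculantInverseExplicit` (VR22 Corollary 2.1, §5.1–5.2: INVERTIBLE band circulants) lists
"§5.3 (the pseudoinverse `Δ⁺`, QTT ranks `≤ 4`)" as not formalised; this file supplies it.

## The statements (verbatim)

[PHW16, §2]: "Let `L` be an `N × N` matrix.  We say that `L` is a difference matrix if it satisfies
the following properties.  (i) The matrix `L` is symmetric and of rank `N − 1`; (ii) `L 𝟙 = 0`
where `𝟙 := (1, …, 1)ᵀ ∈ ℝ^N`, i.e., `𝟙` is the eigenvector of `L` to the single eigenvalue `0`.
[…] a discretization of the second derivative (one-dimensional Laplace) with periodic boundary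
conditions yields a circulant matrix `L = A = circ(−2, 1, 0, …, 0, 1)ᵀ ∈ ℝ^{N×N}` (2.1), while
for Neumann conditions, we consider `L = B := tridiag(1, −2, 1)` with the corner entries
`B_{00} = B_{N−1,N−1} = −1` (2.2).  […] in the periodic case `L = −A²` […] and in the case of
reflecting boundary conditions `L = −B²`.  All these matrices satisfy the properties (i) and (ii)."
"**Theorem 2.1.** For a difference matrix `L ∈ ℝ^{N×N}` satisfying the conditions (i) and (ii) we
obtain the Moore–Penrose inverse in the form `L⁺ = (L − τJ)⁻¹ + (1/(τN²)) J`, where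
`τ ∈ ℝ ∖ {0}` can be chosen arbitrarily, and `J` is the `N × N` matrix where every element is set
to `1`.  In particular, `L⁺` does not depend on the choice of `τ`.  Further, `L⁺` is symmetric."
(Proof: "`L − τJ` is a regular matrix for all `τ ∈ ℝ ∖ {0}`"; "`L L⁺ = L⁺ L = I − J/N`".)
"**Theorem 2.2.** The Moore–Penrose inverse of the circulant matrix `A` in (2.1) is a symmetric
matrix of the form `A⁺ = circ(a⁺_0, a⁺_1, …, a⁺_{N−1})`, where
`a⁺_j = (1/(12N))(1 − N²) + (1/(2N)) j(N − j)`, `j = 0, …, N − 1`."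
"**Theorem 2.3.** The Moore–Penrose inverse for the discrete biharmonic operator `L = −A²` with `A`
in (2.1) with periodic boundary conditions is a symmetric matrix of the form
`L⁺ = −(A²)⁺ = circ(c⁺_0, c⁺_1, …, c⁺_{N−1})` with
`c⁺_k = (1 − N²)(N² + 11)/(720N) + k(N − k)(Nk − k² + 2)/(24N)`, `k = 0, …, N − 1`."
(Proof: "From `(A²)⁺ = (A⁺)²` it follows that `−c⁺_k = Σ_{j=0}^{k} a⁺_j a⁺_{k−j} + …`".)
"**Theorem 2.5.** The Moore–Penrose inverse of the matrix `B` in (2.2) occurring by discretization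
of the Laplacian in the case of homogeneous Neumann boundary conditions is a symmetric matrix of
the form `B⁺ = (b⁺_{j,k})_{j,k=0}^{N−1}` with
`b⁺_{j,k} = −(N−1)(2N−1)/(6N) + j − j(j+1)/(2N) − k(k+1)/(2N)` for `j ≥ k`."
"**Theorem 2.6.** The Moore–Penrose inverse for the discrete biharmonic operator `L = −B²` with
`B` in (2.2) is a symmetric matrix of the form `L⁺ = −(B²)⁺ = (d⁺_{j,k})_{j,k=0}^{N−1}` with
`d⁺_{j,k} = −(N²−1)(4N²−1)/(180N) + [j(j+1)+k(k+1)]²/(24N) + j(j+1)k(k+1)/(6N)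
+ (N/6)[j(j+1)+k(k+1)] − ((2j+1)/12)[j(j+1)+3k(k+1)]` for `j ≥ k`."

[VR22, §5.3] (stiffness matrix `Δ = circ(2, −1, 0, …, 0, −1) ∈ ℝ^{N×N}`, i.e. `Δ = −A`):
"**Proposition 5.2.** The pseudoinverse of `Δ` is a circulant `Δ⁺` with elements
`(Δ⁺)_{i,j} = f((i − j) mod N)` where `f(i) = (6i² − 6Ni + N² − 1)/(12N)`."
"**Corollary 5.2.** For any positive integer `L` the QTT ranks of pseudoinverse `Δ⁺` of stiffness
matrix `Δ ∈ ℝ^{b^L × b^L}` do not exceed `4`."  (Proof in the paper: `f` is a polynomial of degree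
`2` in `i`, i.e. `f(i) = P(i)·1^i`, so Corollary 3.2 applies with `s = 1`, `p_1 = 2`:
ranks `≤ s + 1 + p_1 = 4`.)

## What is proved here (over an `RCLike` field `𝕜` where a pseudoinverse is involved; the algebraic
## identities over any field of characteristic `0`, the circulant bookkeeping over any `CommRing`)

* §E `ones K n = J` and its algebra (`ones_mul_ones : J² = N J`, `mul_ones_apply`,
  `ones_mul_apply`, `mul_ones_eq_zero : L𝟙 = 0 → LJ = 0`, `ones_mulVec`, `one_vecMul_ones`,
  `ones_mul_circulant : J circ(v) = (Σ v) J`, `circulant_mul_ones`).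
* §F THEOREM 2.1: with the hypotheses "`L` Hermitian, `L 𝟙 = 0`, `ker L = constants`" (the
  content of (i)–(ii); `exists_eq_const_of_mulVec_eq_zero` derives the kernel statement from the
  literal "(i) rank `N − 1`, (ii) `L𝟙 = 0`") and `τ ≠ 0`: `L − τJ` is invertible
  (`isUnit_sub_smul_ones`); `differencePinv 𝕜 n L τ = (L − τJ)⁻¹ + J/(τN²)` satisfies the four
  Penrose equations and `L L⁺ = L⁺ L = I − J/N` (`isMoorePenroseInverse_differencePinv`); hence
  `pinv L = (L − τJ)⁻¹ + J/(τN²)` for every `τ ≠ 0` (`pinv_eq_differencePinv`,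
  `pinv_eq_differencePinv_of_rank`), `L L⁺ = L⁺ L = I − J/N` (`mul_pinv_of_differenceMatrix`),
  `L⁺` Hermitian (`isHermitian_pinv_of_differenceMatrix`); also `(−A)⁺ = −A⁺` (`pinv_neg`) and
  `(A²)⁺ = (A⁺)²` when `A A⁺ = A⁺ A` (`isMoorePenroseInverse_mul_self_of_commute`).
  Proof of regularity (ours, spectral-theorem-free): if `(L − τJ)u = 0` then
  `0 = 𝟙ᵀ(L − τJ)u = −τN Σu`, so `Σu = 0`, `Ju = 0`, `Lu = 0`, `u` constant, `u = 0`.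
* §G the periodic Laplacian as a circulant: `laplaceP K N = circ(2e₀ − e₁ − e₋₁)`
  (`lapPCol`, `laplaceP_eq_circulant`, any `N ≥ 1`; for `N = 1, 2` the Kronecker deltas overlap,
  giving `(0)` and `circ(2, −2)` on both sides), the stencil `(Δw)_i = 2w_i − w_{i+1} − w_{i−1}`
  (`laplaceP_mulVec_apply`), `Δ𝟙 = 0`, `JΔ = ΔJ = 0`.
* §H PROPOSITION 5.2 = THEOREM 2.2: `lapPinvFun K N x = (6x² − 6Nx + N² − 1)/(12N)`,
  `lapPinvCol K N j = f(j)`; the discrete equation `2f(x) − f(x+1) − f(x−1) = −1/N`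
  (`lapPinvFun_stencil`), the wrap-around defect `f(x + N) = f(x) + x` (`lapPinvFun_add_natCast`,
  so `f(N) = f(0)`, `f(N−1) = f(−1) − 1`), `Σ_{j<N} f(j) = 0` (`sum_lapPinvCol`, from the power
  sums `Σ j`, `Σ j²`); hence `Δ circ(f) = circ(f) Δ = I − J/N`
  (`laplaceP_mul_circulant_lapPinvCol`),
  `J circ(f) = 0`, the four Penrose equations (`isMoorePenroseInverse_laplaceP`, every `N`), and
  `pinv (laplaceP 𝕜 N) = circ(f)` (`pinv_laplaceP`; entrywise `pinv_laplaceP_apply`: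
  `(Δ⁺)_{ij} = f((i − j) mod N)` with `(i − j) mod N` the subtraction of `Fin N = ℤ/N`); Theorem 2.2
  as printed for `A = −Δ`: `(A⁺)_{ik} = (1 − N²)/(12N) + j(N − j)/(2N)`, `j = (i − k) mod N`
  (`pinv_neg_laplaceP_apply`); `Δ Δ⁺ = Δ⁺ Δ = I − J/N` (`laplaceP_mul_pinv`, `pinv_mul_laplaceP`),
  `J Δ⁺ = 0`, and the periodic Poisson solve `Δ (Δ⁺ g) = g` for mean-zero `g`
  (`laplaceP_mulVec_pinv_mulVec`).
* §I THEOREM 2.3: `biLapPinvFun K N x = (N² − 1)(N² + 11)/(720N) − x(N − x)(Nx − x² + 2)/(24N)`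
  (`= −c⁺_x`); `2g(x) − g(x+1) − g(x−1) = f(x)` (`biLapPinvFun_stencil`), no wrap-around defect
  (`g(N) = g(0)`, `g(N − 1) = g(−1)`), `Σ_{j<N} g(j) = 0` (`sum_biLapPinvCol`, power sums up to
  `Σ j⁴`); hence `Δ circ(g) = Δ⁺` (`laplaceP_mul_circulant_biLapPinvCol`), `(Δ⁺)² = circ(g)`
  (`pinv_laplaceP_mul_self`), the Penrose equations for `(Δ², circ(g))`
  (`isMoorePenroseInverse_laplaceP_sq`), `pinv (Δ Δ) = circ(g)` (`pinv_laplaceP_sq`) and Theorem 2.3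
  as printed, `((−A²)⁺)_{ij} = c⁺_k`, `k = (i − j) mod N` (`pinv_neg_laplaceP_sq_apply`).
  Proof of `(Δ⁺)² = circ(g)` (ours, convolution-free): `Δ circ(g) = Δ⁺` and `J circ(g) = 0` give
  `(Δ⁺)² = Δ⁺ (Δ circ(g)) = (I − J/N) circ(g) = circ(g)`.
* §J COROLLARY 5.2: `f = P(i)·1^i` with `P = lapPinvPoly`, `deg P ≤ 2` (`eval_lapPinvPoly`,
  `natDegree_lapPinvPoly_le`), so by Corollary 3.2 of `QTTCirculantRankBounds` every QTT unfolding
  matrix of `Δ⁺ ∈ 𝕜^{b^L × b^L}` has rank `≤ 1 + 1 + 2 = 4` (`rank_qttUnfolding_pinv_laplaceP_le`,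
  any base `b`, any `L`, `l + m = L`), and over `ℝ` `Δ⁺` is the matrix of an explicit tensor train
  with boundary ranks `1` and interior ranks `≤ 4` (`exists_qttMatrix_pinv_laplaceP`).
* §K THEOREM 2.5 (`Δ_NN = laplaceNN K N = −B`): the kernel `lapNNPinvFun K N i j = g_N(i,j)
  = (N−1)(2N−1)/(6N) + (i(i+1) + j(j+1))/(2N) − max(i,j)` on `ℤ × ℤ` and the matrix
  `lapNNPinv K N = (g_N(i,j))_{i,j<N}`; the Neumann stencil of `Δ_NN` with ghost values
  (`sum_laplaceNN_mul`: `(Δ_NN G)_i = 2G(i) − G(i−1) − G(i+1)` with `G(−1) := G(0)`,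
  `G(N) := G(N−1)`), `Δ_NNᵀ = Δ_NN`, `Δ_NN 𝟙 = 0`, `JΔ_NN = Δ_NN J = 0`; the free stencil
  `2g(i,k) − g(i−1,k) − g(i+1,k) = δ_{ik} − 1/N` on all of `ℤ` (`lapNNPinvFun_stencil`) and the
  reflection identities `g(−1,k) = g(0,k)`, `g(N,k) = g(N−1,k)` (`lapNNPinvFun_neg_one`,
  `lapNNPinvFun_natCast`) — so the ghost values are invisible; hence `Δ_NN (g_N) = I − J/N`
  (`laplaceNN_mul_lapNNPinv`), `Σ_i g_N(i,k) = 0` (`sum_lapNNPinvFun`, `ones_mul_lapNNPinv`), the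
  mechanism "`L, X` symmetric, `LX = I − J/N`, `JX = JL = 0` ⟹ Penrose"
  (`isMoorePenroseInverse_of_mul_eq_one_sub`), the Penrose equations
  (`isMoorePenroseInverse_laplaceNN`), `pinv (laplaceNN 𝕜 N) = lapNNPinv 𝕜 N` (`pinv_laplaceNN`,
  `pinv_laplaceNN_apply`), Theorem 2.5 verbatim for `B = −Δ_NN` (`pinv_neg_laplaceNN_apply`:
  `(B⁺)_{jk} = −(N−1)(2N−1)/(6N) + j − j(j+1)/(2N) − k(k+1)/(2N)`, `k ≤ j`),
  `Δ_NN Δ_NN⁺ = Δ_NN⁺ Δ_NN = I − J/N` and the Neumann solve `Δ_NN(Δ_NN⁺ g) = g` for mean-zero `g`.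
* §L THEOREM 2.6: the kernel `biLapNNPinvFun K N i j = h_N(i,j) = −d⁺_{ij}` on `ℤ × ℤ` and
  `biLapNNPinv K N = (h_N(i,j))_{i,j<N}`; `2h(i,k) − h(i−1,k) − h(i+1,k) = g(i,k)` on all of `ℤ`
  (`biLapNNPinvFun_stencil`), the reflection identities, hence `Δ_NN (h_N) = (g_N)`
  (`laplaceNN_mul_biLapNNPinv`); `J (h_N) = 0` (`ones_mul_biLapNNPinv`) by a symmetry argument
  (`G² = G Δ_NN H = H − JH/N` with `G = (g_N)`, `H = (h_N)` symmetric forces all column sums of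
  `H` to agree, and the zeroth vanishes, `sum_biLapNNPinvFun_zero`, power sums up to `Σ x⁴`);
  therefore `(Δ_NN⁺)² = (h_N)` (`pinv_laplaceNN_mul_self`), the Penrose equations for
  `(Δ_NN², (h_N))` (`isMoorePenroseInverse_laplaceNN_sq`), `pinv (Δ_NN Δ_NN) = biLapNNPinv`
  (`pinv_laplaceNN_sq`) and Theorem 2.6 verbatim, `((−B²)⁺)_{jk} = d⁺_{j,k}` for `k ≤ j`
  (`pinv_neg_laplaceNN_sq_apply`).

CONVENTIONS.  `Δ = laplaceP K N` is VR22's stiffness matrix `S = circ(2, −1, 0, …, 0, −1)` and PHW's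
`−A`; `Δ_NN = laplaceNN K N` (`tridiag(−1, 2, −1)` with corner diagonal entries `1`) is PHW's `−B`;
since `(−A)⁺ = −A⁺`, PHW's kernels are the negatives of ours (`a⁺ = −f`, `c⁺ = −g`, `b⁺ = −g_N`,
`d⁺ = −h_N`), and the printed forms are all stated.  All statements hold for every `N` (for
`N = 0` all matrices are empty, for `N = 1` `Δ = Δ_NN = 0` and all kernels vanish); `N` is cast
into the field, so "`/ (12N)`" is the field division (the kernel identities assume `N ≠ 0` in `K`,
automatic in characteristic `0` for `N ≥ 1`).

Not formalised here: PHW16 Theorem 2.4 (the Fourier diagonalisation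
`A⁺ = F* diag(0, −1/(4 sin²(πk/N))) F`), PHW's proof of Theorem 2.5 via the `N × N` blocks of
`A_{2N}⁺` (we verify the stencil identities directly), §3 (sparse signal approximation); VR22's
derivation of Prop. 5.2 as the limit `α → 0` of `(Δ_α)⁻¹ S`; QTT ranks of `Δ_NN⁺` (not stated
in the sources).

AI-produced formalisation (H21 engines group, seat eng-quad-2, 2026-08-23); statements checked
against the arXiv texts; no facts, no axioms beyond Mathlib's, no `sorry`.
-/

open Matrix Finset Polynomial

namespace Literature.LinearAlgebra.TensorNetworks

open Literature.LinearAlgebra.Matrix.MoorePenrose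

/-! ## E. The all-ones matrix `J` [PHW16, §2] -/

section Ones

variable (K : Type*) [CommRing K] (n : Type*)

/-- `J`, "the `N × N` matrix where every element is set to `1`" of [PHW16, Thm. 2.1].
[cite: PlonkaHoffmannWeickert2016, Thm. 2.1] -/
def ones : Matrix n n K := Matrix.of fun _ _ => 1

variable {K n}

/-- Entries of `J`.  [cite: PlonkaHoffmannWeickert2016, Thm. 2.1] -/
@[simp] theorem ones_apply (i j : n) : ones K n i j = 1 := rfl

/-- `Jᵀ = J`.  [cite: PlonkaHoffmannWeickert2016, Thm. 2.1] -/
theorem transpose_ones : (ones K n)ᵀ = ones K n := by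
  ext i j; rfl

/-- `Jᴴ = J`.  [cite: PlonkaHoffmannWeickert2016, Thm. 2.1] -/
theorem conjTranspose_ones [StarRing K] : (ones K n)ᴴ = ones K n := by
  ext i j; simp

/-- `J` is Hermitian (symmetric).  [cite: PlonkaHoffmannWeickert2016, Thm. 2.1] -/
theorem isHermitian_ones [StarRing K] : (ones K n).IsHermitian := conjTranspose_ones

variable [Fintype n]

/-- "`J² = N J`".  [cite: PlonkaHoffmannWeickert2016, Thm. 2.1 (proof)] -/
theorem ones_mul_ones : ones K n * ones K n = (Fintype.card n : K) • ones K n := by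
  ext i j; simp [Matrix.mul_apply]

/-- `(L J)_{ij} = (L 𝟙)_i`: the entries of `L J` are the row sums of `L`.
[cite: PlonkaHoffmannWeickert2016, Thm. 2.1 (proof)] -/
theorem mul_ones_apply (L : Matrix n n K) (i j : n) : (L * ones K n) i j = (L *ᵥ 1) i := by
  simp [Matrix.mul_apply, Matrix.mulVec, dotProduct]

/-- `(J L)_{ij} = (𝟙ᵀ L)_j`: the entries of `J L` are the column sums of `L`.
[cite: PlonkaHoffmannWeickert2016, Thm. 2.1 (proof)] -/
theorem ones_mul_apply (L : Matrix n n K) (i j : n) : (ones K n * L) i j = (1 ᵥ* L) j := by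
  simp [Matrix.mul_apply, Matrix.vecMul, dotProduct]

/-- "`L J = 0`" as soon as `L 𝟙 = 0` (hypothesis (ii) of [PHW16, §2]).
[cite: PlonkaHoffmannWeickert2016, Thm. 2.1 (proof)] -/
theorem mul_ones_eq_zero {L : Matrix n n K} (h : L *ᵥ 1 = 0) : L * ones K n = 0 := by
  ext i j; rw [mul_ones_apply, h]; rfl

/-- "`J L = 0`" as soon as `𝟙ᵀ L = 0`.  [cite: PlonkaHoffmannWeickert2016, Thm. 2.1 (proof)] -/
theorem ones_mul_eq_zero {L : Matrix n n K} (h : 1 ᵥ* L = 0) : ones K n * L = 0 := by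
  ext i j; rw [ones_mul_apply, h]; rfl

/-- `J v = (Σ_j v_j) 𝟙`.  [cite: PlonkaHoffmannWeickert2016, Thm. 2.1 (proof)] -/
theorem ones_mulVec (v : n → K) : ones K n *ᵥ v = fun _ => ∑ j, v j := by
  ext i; simp [Matrix.mulVec, dotProduct]

/-- `𝟙ᵀ J = N 𝟙ᵀ` (eq. (2.3) of the proof: `𝟙ᵀ(L − τJ) = −τN 𝟙ᵀ`).
[cite: PlonkaHoffmannWeickert2016, Thm. 2.1 (proof, eq. (2.3))] -/
theorem one_vecMul_ones : (1 : n → K) ᵥ* ones K n = fun _ => (Fintype.card n : K) := by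
  ext j; simp [Matrix.vecMul, dotProduct]

/-- For a Hermitian (real: symmetric) `L`, `L 𝟙 = 0` gives `𝟙ᵀ L = 0` as well.
[cite: PlonkaHoffmannWeickert2016, Thm. 2.1 (proof)] -/
theorem one_vecMul_eq_zero_of_isHermitian [StarRing K] {L : Matrix n n K} (hL : L.IsHermitian)
    (h : L *ᵥ 1 = 0) : 1 ᵥ* L = 0 := by
  have h' := congrArg star h
  rw [Matrix.star_mulVec, hL.eq, star_one, star_zero] at h'
  exact h'

/-- Column sums of a circulant: `Σ_i circ(v)_{ij} = Σ_i v_i`.  [folklore: reindexing] -/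
private theorem sum_circulant_col {N : ℕ} (v : Fin N → K) (j : Fin N) :
    ∑ i, Matrix.circulant v i j = ∑ i, v i := by
  cases N with
  | zero => exact Fin.elim0 j
  | succ n => exact Fintype.sum_equiv (Equiv.subRight j) _ _ fun _ => rfl

/-- Row sums of a circulant: `Σ_j circ(v)_{ij} = Σ_j v_j`.  [folklore: reindexing] -/
private theorem sum_circulant_row {N : ℕ} (v : Fin N → K) (i : Fin N) :
    ∑ j, Matrix.circulant v i j = ∑ j, v j := by
  cases N with
  | zero => exact Fin.elim0 i
  | succ n => exact Fintype.sum_equiv (Equiv.subLeft i) _ _ fun _ => rfl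

/-- `J circ(v) = (Σ v) J`: a circulant whose column sums vanish is killed by `J` on the left
(used for `J A = 0`, `J A⁺ = 0` in [PHW16, Thms. 2.1–2.3]).
[cite: PlonkaHoffmannWeickert2016, Thm. 2.1 (proof)] -/
theorem ones_mul_circulant {N : ℕ} (v : Fin N → K) :
    ones K (Fin N) * Matrix.circulant v = (∑ i, v i) • ones K (Fin N) := by
  ext i j
  simp only [Matrix.mul_apply, ones_apply, one_mul, Matrix.smul_apply, smul_eq_mul, mul_one]
  exact sum_circulant_col v j

/-- `circ(v) J = (Σ v) J`.  [cite: PlonkaHoffmannWeickert2016, Thm. 2.1 (proof)] -/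
theorem circulant_mul_ones {N : ℕ} (v : Fin N → K) :
    Matrix.circulant v * ones K (Fin N) = (∑ i, v i) • ones K (Fin N) := by
  ext i j
  simp only [Matrix.mul_apply, ones_apply, mul_one, Matrix.smul_apply, smul_eq_mul]
  exact sum_circulant_row v i

end Ones

/-! ## F. THEOREM 2.1 of [PHW16]: the Moore–Penrose inverse of a difference matrix -/

section DifferenceMatrix

variable {𝕜 : Type*} [RCLike 𝕜] {n : Type*} [Fintype n]

/-- Hypotheses (i) ("`L` has rank `N − 1`") and (ii) ("`L 𝟙 = 0`") of [PHW16, §2] say that the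
kernel of `L` is the line of constant vectors ("`𝟙` is the eigenvector to the single eigenvalue
`0`").  [cite: PlonkaHoffmannWeickert2016, §2 (i)–(ii)] -/
theorem exists_eq_const_of_mulVec_eq_zero {L : Matrix n n 𝕜} (h1 : L *ᵥ 1 = 0)
    (hrank : L.rank + 1 = Fintype.card n) {v : n → 𝕜} (hv : L *ᵥ v = 0) :
    ∃ c : 𝕜, v = fun _ => c := by
  have hker : Module.finrank 𝕜 (LinearMap.ker L.mulVecLin) = 1 := by
    have h := L.mulVecLin.finrank_range_add_finrank_ker
    rw [Module.finrank_fintype_fun_eq_card] at h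
    change L.rank + _ = _ at h
    omega
  have h1' : (1 : n → 𝕜) ∈ LinearMap.ker L.mulVecLin := by
    rw [LinearMap.mem_ker, Matrix.mulVecLin_apply, h1]
  have hv' : v ∈ LinearMap.ker L.mulVecLin := by
    rw [LinearMap.mem_ker, Matrix.mulVecLin_apply, hv]
  have hne : (⟨1, h1'⟩ : LinearMap.ker L.mulVecLin) ≠ 0 := by
    intro h0
    have hcard : 0 < Fintype.card n := by omega
    obtain ⟨i⟩ := Fintype.card_pos_iff.mp hcard
    have := congrArg (fun w : LinearMap.ker L.mulVecLin => (w : n → 𝕜) i) h0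
    simp at this
  obtain ⟨c, hc⟩ := (finrank_eq_one_iff_of_nonzero' _ hne).mp hker ⟨v, hv'⟩
  refine ⟨c, ?_⟩
  have hc' := congrArg (fun w : LinearMap.ker L.mulVecLin => (w : n → 𝕜)) hc
  ext i
  have := congrFun hc' i
  simpa using this.symm

variable [DecidableEq n]

/-- THEOREM 2.1 of [PHW16], first step: for a Hermitian `L` with `L 𝟙 = 0` whose kernel is the
constants, "`L − τJ` is a regular matrix for all `τ ≠ 0`".
[cite: PlonkaHoffmannWeickert2016, Thm. 2.1 (proof)] -/
theorem isUnit_sub_smul_ones {L : Matrix n n 𝕜} (hL : L.IsHermitian) (h1 : L *ᵥ 1 = 0)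
    (hker : ∀ v : n → 𝕜, L *ᵥ v = 0 → ∃ c : 𝕜, v = fun _ => c) {τ : 𝕜} (hτ : τ ≠ 0) :
    IsUnit (L - τ • ones 𝕜 n) := by
  cases isEmpty_or_nonempty n
  · exact isUnit_of_subsingleton _
  have hN : (Fintype.card n : 𝕜) ≠ 0 := Nat.cast_ne_zero.mpr Fintype.card_ne_zero
  rw [← Matrix.mulVec_injective_iff_isUnit]
  intro v w hvw
  rw [← sub_eq_zero]
  set u := v - w with hu_def
  have hu : (L - τ • ones 𝕜 n) *ᵥ u = 0 := by
    rw [hu_def, Matrix.mulVec_sub, hvw, sub_self]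
  have hJu : ones 𝕜 n *ᵥ u = fun _ => ∑ j, u j := ones_mulVec u
  -- the sum of the entries of `u` vanishes: `0 = 𝟙ᵀ (L − τJ) u = −τ N Σ u`
  have hsum : ∑ j, u j = 0 := by
    have h := congrArg (fun x => (1 : n → 𝕜) ⬝ᵥ x) hu
    simp only [dotProduct_zero, Matrix.dotProduct_mulVec, Matrix.vecMul_sub, Matrix.vecMul_smul,
      one_vecMul_eq_zero_of_isHermitian hL h1, one_vecMul_ones, zero_sub] at h
    have h' : -(τ * (Fintype.card n : 𝕜)) * ∑ j, u j = 0 := by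
      rw [← h]
      simp [dotProduct, Finset.mul_sum]
    rcases mul_eq_zero.mp h' with h'' | h''
    · exact absurd h'' (neg_ne_zero.mpr (mul_ne_zero hτ hN))
    · exact h''
  have hLu : L *ᵥ u = 0 := by
    have : L *ᵥ u = (L - τ • ones 𝕜 n) *ᵥ u + τ • (ones 𝕜 n *ᵥ u) := by
      rw [Matrix.sub_mulVec, Matrix.smul_mulVec, sub_add_cancel]
    rw [this, hu, hJu, hsum, zero_add]
    ext i; simp
  obtain ⟨c, hc⟩ := hker u hLu
  have hc0 : c = 0 := by
    rw [hc] at hsum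
    simp only [Finset.sum_const, Finset.card_univ, nsmul_eq_mul] at hsum
    rcases mul_eq_zero.mp hsum with h | h
    · exact absurd h hN
    · exact h
  rw [hc, hc0]; rfl

variable (𝕜 n) in
/-- The right-hand side of [PHW16, eq. (2.1)]: `(L − τJ)⁻¹ + J/(τN²)`.
[cite: PlonkaHoffmannWeickert2016, Thm. 2.1, eq. (2.1)] -/
noncomputable def differencePinv (L : Matrix n n 𝕜) (τ : 𝕜) : Matrix n n 𝕜 :=
  (L - τ • ones 𝕜 n)⁻¹ + (τ * (Fintype.card n : 𝕜) ^ 2)⁻¹ • ones 𝕜 n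

/-- THEOREM 2.1 of [PHW16]: for a Hermitian `L ∈ 𝕜^{N×N}` with `L 𝟙 = 0` whose kernel is the
constants (hypotheses (i)–(ii)) and any `τ ≠ 0`, the matrix `(L − τJ)⁻¹ + J/(τN²)` satisfies the
four Penrose equations, and (eqs. (2.4)–(2.5) of the proof) "`L L⁺ = L⁺ L = I − J/N`".
[cite: PlonkaHoffmannWeickert2016, Thm. 2.1] -/
theorem isMoorePenroseInverse_differencePinv {L : Matrix n n 𝕜} (hL : L.IsHermitian)
    (h1 : L *ᵥ 1 = 0) (hker : ∀ v : n → 𝕜, L *ᵥ v = 0 → ∃ c : 𝕜, v = fun _ => c) {τ : 𝕜}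
    (hτ : τ ≠ 0) :
    IsMoorePenroseInverse L (differencePinv 𝕜 n L τ) ∧
      L * differencePinv 𝕜 n L τ = 1 - (Fintype.card n : 𝕜)⁻¹ • ones 𝕜 n ∧
      differencePinv 𝕜 n L τ * L = 1 - (Fintype.card n : 𝕜)⁻¹ • ones 𝕜 n := by
  cases isEmpty_or_nonempty n
  · refine ⟨⟨?_, ?_, ?_, ?_⟩, ?_, ?_⟩ <;> exact Matrix.ext fun i => isEmptyElim i
  have hN : (Fintype.card n : 𝕜) ≠ 0 := Nat.cast_ne_zero.mpr Fintype.card_ne_zero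
  unfold differencePinv
  set N : 𝕜 := (Fintype.card n : 𝕜) with hN_def
  set J := ones 𝕜 n with hJ_def
  set M := L - τ • J with hM_def
  have hM : IsUnit M := isUnit_sub_smul_ones hL h1 hker hτ
  have hMdet : IsUnit M.det := (Matrix.isUnit_iff_isUnit_det _).mp hM
  have hMM : M * M⁻¹ = 1 := Matrix.mul_nonsing_inv _ hMdet
  have hMM' : M⁻¹ * M = 1 := Matrix.nonsing_inv_mul _ hMdet
  have hLJ : L * J = 0 := mul_ones_eq_zero h1
  have hJL : J * L = 0 := ones_mul_eq_zero (one_vecMul_eq_zero_of_isHermitian hL h1)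
  have hJJ : J * J = N • J := ones_mul_ones
  have hτN : τ * N ≠ 0 := mul_ne_zero hτ hN
  have hLM : L = M + τ • J := by rw [hM_def, sub_add_cancel]
  have hMJ : M * J = (-(τ * N)) • J := by
    rw [hM_def, sub_mul, hLJ, smul_mul_assoc, hJJ, smul_smul, zero_sub, neg_smul]
  have hJM : J * M = (-(τ * N)) • J := by
    rw [hM_def, mul_sub, hJL, Matrix.mul_smul, hJJ, smul_smul, zero_sub, neg_smul]
  have hMiJ : M⁻¹ * J = (-(τ * N)⁻¹) • J := by
    have h : (-(τ * N)) • (M⁻¹ * J) = J := by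
      rw [← Matrix.mul_smul, ← hMJ, ← Matrix.mul_assoc, hMM', Matrix.one_mul]
    calc M⁻¹ * J = (-(τ * N))⁻¹ • ((-(τ * N)) • (M⁻¹ * J)) := by
          rw [smul_smul, inv_mul_cancel₀ (neg_ne_zero.mpr hτN), one_smul]
      _ = (-(τ * N)⁻¹) • J := by rw [h, inv_neg]
  have hJMi : J * M⁻¹ = (-(τ * N)⁻¹) • J := by
    have h : (-(τ * N)) • (J * M⁻¹) = J := by
      rw [← smul_mul_assoc, ← hJM, Matrix.mul_assoc, hMM, Matrix.mul_one]
    calc J * M⁻¹ = (-(τ * N))⁻¹ • ((-(τ * N)) • (J * M⁻¹)) := by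
          rw [smul_smul, inv_mul_cancel₀ (neg_ne_zero.mpr hτN), one_smul]
      _ = (-(τ * N)⁻¹) • J := by rw [h, inv_neg]
  have hcoef : τ * (τ * N)⁻¹ = N⁻¹ := by
    rw [mul_inv, ← mul_assoc, mul_inv_cancel₀ hτ, one_mul]
  have hcoef2 : (τ * N ^ 2)⁻¹ * N = (τ * N)⁻¹ := by
    field_simp
  have hLX : L * (M⁻¹ + (τ * N ^ 2)⁻¹ • J) = 1 - N⁻¹ • J := by
    calc L * (M⁻¹ + (τ * N ^ 2)⁻¹ • J) = L * M⁻¹ + (τ * N ^ 2)⁻¹ • (L * J) := by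
          rw [mul_add, Matrix.mul_smul]
      _ = L * M⁻¹ := by rw [hLJ, smul_zero, add_zero]
      _ = M * M⁻¹ + τ • (J * M⁻¹) := by
          conv_lhs => rw [hLM]
          rw [add_mul, smul_mul_assoc]
      _ = 1 + τ • ((-(τ * N)⁻¹) • J) := by rw [hMM, hJMi]
      _ = 1 - N⁻¹ • J := by rw [smul_smul, mul_neg, hcoef, neg_smul, ← sub_eq_add_neg]
  have hXL : (M⁻¹ + (τ * N ^ 2)⁻¹ • J) * L = 1 - N⁻¹ • J := by
    calc (M⁻¹ + (τ * N ^ 2)⁻¹ • J) * L = M⁻¹ * L + (τ * N ^ 2)⁻¹ • (J * L) := by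
          rw [add_mul, smul_mul_assoc]
      _ = M⁻¹ * L := by rw [hJL, smul_zero, add_zero]
      _ = M⁻¹ * M + τ • (M⁻¹ * J) := by
          conv_lhs => rw [hLM]
          rw [mul_add, Matrix.mul_smul]
      _ = 1 + τ • ((-(τ * N)⁻¹) • J) := by rw [hMM', hMiJ]
      _ = 1 - N⁻¹ • J := by rw [smul_smul, mul_neg, hcoef, neg_smul, ← sub_eq_add_neg]
  have hJX : J * (M⁻¹ + (τ * N ^ 2)⁻¹ • J) = 0 := by
    calc J * (M⁻¹ + (τ * N ^ 2)⁻¹ • J) = J * M⁻¹ + (τ * N ^ 2)⁻¹ • (J * J) := by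
          rw [mul_add, Matrix.mul_smul]
      _ = (-(τ * N)⁻¹) • J + ((τ * N ^ 2)⁻¹ * N) • J := by rw [hJMi, hJJ, smul_smul]
      _ = 0 := by rw [hcoef2, ← add_smul, neg_add_cancel, zero_smul]
  have hP : (1 - N⁻¹ • J : Matrix n n 𝕜).IsHermitian :=
    Matrix.isHermitian_one.sub (isHermitian_ones.smul (IsSelfAdjoint.natCast _).inv₀)
  refine ⟨⟨?_, ?_, ?_, ?_⟩, hLX, hXL⟩
  · rw [hLX, sub_mul, one_mul, smul_mul_assoc, hJL, smul_zero, sub_zero]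
  · rw [hXL, sub_mul, one_mul, smul_mul_assoc, hJX, smul_zero, sub_zero]
  · rw [hLX]; exact hP
  · rw [hXL]; exact hP

/-- THEOREM 2.1 of [PHW16], as printed: "`L⁺ = (L − τJ)⁻¹ + J/(τN²)`".
[cite: PlonkaHoffmannWeickert2016, Thm. 2.1, eq. (2.1)] -/
theorem pinv_eq_differencePinv {L : Matrix n n 𝕜} (hL : L.IsHermitian) (h1 : L *ᵥ 1 = 0)
    (hker : ∀ v : n → 𝕜, L *ᵥ v = 0 → ∃ c : 𝕜, v = fun _ => c) {τ : 𝕜} (hτ : τ ≠ 0) :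
    pinv L = (L - τ • ones 𝕜 n)⁻¹ + (τ * (Fintype.card n : 𝕜) ^ 2)⁻¹ • ones 𝕜 n :=
  (isMoorePenroseInverse_iff_eq_pinv.mp (isMoorePenroseInverse_differencePinv hL h1 hker hτ).1).symm

/-- THEOREM 2.1 of [PHW16] under the paper's literal hypotheses (i) `rank L = N − 1` and
(ii) `L 𝟙 = 0` (for symmetric `L`): "`L⁺ = (L − τJ)⁻¹ + J/(τN²)`" for every `τ ≠ 0`.
[cite: PlonkaHoffmannWeickert2016, Thm. 2.1] -/
theorem pinv_eq_differencePinv_of_rank {L : Matrix n n 𝕜} (hL : L.IsHermitian)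
    (hrank : L.rank + 1 = Fintype.card n) (h1 : L *ᵥ 1 = 0) {τ : 𝕜} (hτ : τ ≠ 0) :
    pinv L = (L - τ • ones 𝕜 n)⁻¹ + (τ * (Fintype.card n : 𝕜) ^ 2)⁻¹ • ones 𝕜 n :=
  pinv_eq_differencePinv hL h1 (fun _ hv => exists_eq_const_of_mulVec_eq_zero h1 hrank hv) hτ

/-- [PHW16, proof of Thm. 2.1, eqs. (2.4)–(2.5)]: "`L L⁺ = L⁺ L = I − J/N`" — the orthogonal
projector onto the mean-zero vectors.  [cite: PlonkaHoffmannWeickert2016, Thm. 2.1 (proof)] -/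
theorem mul_pinv_of_differenceMatrix {L : Matrix n n 𝕜} (hL : L.IsHermitian) (h1 : L *ᵥ 1 = 0)
    (hker : ∀ v : n → 𝕜, L *ᵥ v = 0 → ∃ c : 𝕜, v = fun _ => c) :
    L * pinv L = 1 - (Fintype.card n : 𝕜)⁻¹ • ones 𝕜 n ∧
      pinv L * L = 1 - (Fintype.card n : 𝕜)⁻¹ • ones 𝕜 n := by
  obtain ⟨_, h2, h3⟩ := isMoorePenroseInverse_differencePinv hL h1 hker (one_ne_zero (α := 𝕜))
  rw [pinv_eq_differencePinv hL h1 hker (one_ne_zero (α := 𝕜))]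
  exact ⟨h2, h3⟩

/-- "Since `L` is symmetric, `L⁺` is also symmetric" [PHW16, proof of Thm. 2.1].
[cite: PlonkaHoffmannWeickert2016, Thm. 2.1 (proof)] -/
theorem isHermitian_pinv_of_differenceMatrix {L : Matrix n n 𝕜} (hL : L.IsHermitian) :
    (pinv L).IsHermitian :=
  isHermitian_pinv_of_isHermitian hL

omit [DecidableEq n] in
/-- Sign changes commute with the Moore–Penrose inverse: `(−A)⁺ = −A⁺` ([PHW16] pass freely
between `A = circ(−2, 1, 0, …, 1)` and the stiffness matrix `−A`).  [folklore: Penrose equations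
are invariant under `(A, X) ↦ (−A, −X)`] -/
private theorem isMoorePenroseInverse_neg {m : Type*} [Fintype m] {A : Matrix m n 𝕜}
    {X : Matrix n m 𝕜} (h : IsMoorePenroseInverse A X) : IsMoorePenroseInverse (-A) (-X) := by
  refine ⟨?_, ?_, ?_, ?_⟩
  · simp only [Matrix.neg_mul, Matrix.mul_neg, neg_neg, h.mul_mul_self]
  · simp only [Matrix.neg_mul, Matrix.mul_neg, neg_neg, h.mul_mul_inv]
  · simp only [Matrix.neg_mul, Matrix.mul_neg, neg_neg]; exact h.isHermitian_mul
  · simp only [Matrix.neg_mul, Matrix.mul_neg, neg_neg]; exact h.isHermitian_inv_mul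

/-- `(−A)⁺ = −A⁺`.  [cite: PlonkaHoffmannWeickert2016, Thm. 2.2 (sign convention
`A = circ(−2,1,0,…,1)` vs. `−A`)] -/
theorem pinv_neg {m : Type*} [Fintype m] [DecidableEq m] (A : Matrix m n 𝕜) :
    pinv (-A) = -pinv A :=
  (isMoorePenroseInverse_iff_eq_pinv.mp
    (isMoorePenroseInverse_neg (isMoorePenroseInverse_pinv A))).symm

omit [DecidableEq n] in
/-- If `X = A⁺` commutes with `A` (e.g. `A` Hermitian, or both circulant), then `(A²)⁺ = (A⁺)²`
(used in [PHW16, Thm. 2.3] for the biharmonic `L = −A²`).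
[cite: PlonkaHoffmannWeickert2016, Thm. 2.3 (proof idea)] -/
theorem isMoorePenroseInverse_mul_self_of_commute {A X : Matrix n n 𝕜}
    (h : IsMoorePenroseInverse A X) (hc : A * X = X * A) :
    IsMoorePenroseInverse (A * A) (X * X) := by
  have hAXX : A * X * X = X := by rw [hc, h.mul_mul_inv]
  have hXAA : X * A * A = A := by rw [← hc, h.mul_mul_self]
  have h1 : A * A * (X * X) = A * X := by
    rw [Matrix.mul_assoc, ← Matrix.mul_assoc A X X, hAXX]
  have h2 : X * X * (A * A) = A * X := by
    rw [Matrix.mul_assoc, ← Matrix.mul_assoc X A A, hXAA, hc]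
  refine ⟨?_, ?_, ?_, ?_⟩
  · rw [h1, ← Matrix.mul_assoc, h.mul_mul_self]
  · rw [h2, ← Matrix.mul_assoc, hAXX]
  · rw [h1]; exact h.isHermitian_mul
  · rw [h2]; exact h.isHermitian_mul

end DifferenceMatrix

/-! ## G. The periodic Laplacian `Δ_P = circ(2, −1, 0, …, 0, −1)` as a circulant -/

section Stencil

variable (K : Type*) [CommRing K]

/-- The first column `2e₀ − e₁ − e₋₁` of the stiffness matrix `Δ = circ(2, −1, 0, …, 0, −1)`
(for `N = 1, 2` the Kronecker deltas overlap: `Δ = (0)`, `Δ = circ(2, −2)`).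
[cite: VysotskyRakhuba2022, §5.3 (stiffness matrix `S`); PlonkaHoffmannWeickert2016, Thm. 2.2
(`A = circ(−2, 1, 0, …, 1) = −Δ`)] -/
def lapPCol (N : ℕ) [NeZero N] : Fin N → K := fun d =>
  (if d = 0 then 2 else 0) - (if d = 1 then 1 else 0) - (if d = -1 then 1 else 0)

variable {K}

/-- `i − j = 1 ↔ i − 1 = j` in `ℤ/N`.  [folklore: group arithmetic] -/
private theorem fin_sub_eq_one_iff {N : ℕ} [NeZero N] (i j : Fin N) :
    i - j = 1 ↔ i - 1 = j :=
  ⟨fun h => by rw [← h]; abel, fun h => by rw [← h]; abel⟩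

/-- `i − j = 1 ↔ j + 1 = i` in `ℤ/N`.  [folklore: group arithmetic] -/
private theorem fin_sub_eq_one_iff' {N : ℕ} [NeZero N] (i j : Fin N) :
    i - j = 1 ↔ j + 1 = i :=
  ⟨fun h => by rw [← h]; abel, fun h => by rw [← h]; abel⟩

/-- `i − j = −1 ↔ i + 1 = j` in `ℤ/N`.  [folklore: group arithmetic] -/
private theorem fin_sub_eq_neg_one_iff {N : ℕ} [NeZero N] (i j : Fin N) :
    i - j = -1 ↔ i + 1 = j :=
  ⟨fun h => by rw [← sub_sub_cancel i j, h, sub_neg_eq_add], fun h => by rw [← h]; abel⟩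

/-- The cyclic successor in `Fin (n+1)` in terms of natural-number values (the wrap-around
disjunction used in the definition of `laplaceP`).  [folklore: `Fin.val_add_one`] -/
private theorem fin_eq_add_one_iff {n : ℕ} (i j : Fin (n + 1)) :
    i + 1 = j ↔ ((j : ℕ) = i + 1 ∨ ((i : ℕ) + 1 = n + 1 ∧ (j : ℕ) = 0)) := by
  have hj := j.isLt
  rw [Fin.ext_iff, Fin.val_add_one]
  split_ifs with h
  · rw [h, Fin.val_last]; omega
  · have hi : (i : ℕ) < n := Fin.val_lt_last h
    omega

/-- `Δ_P` of `QTTLaplace` ("`Δ^{(1)}_P`", [Kazeev–Khoromskij 2012, eq. (1.1)]) is the circulant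
`circ(2, −1, 0, …, 0, −1)` — the stiffness matrix `S` of [VR22, §5.3] and `−A` of [PHW16, Thm. 2.2].
[cite: VysotskyRakhuba2022, §5.3; PlonkaHoffmannWeickert2016, Thm. 2.2] -/
theorem laplaceP_eq_circulant (N : ℕ) [NeZero N] :
    laplaceP K N = Matrix.circulant (lapPCol K N) := by
  obtain ⟨n, hn⟩ := Nat.exists_eq_succ_of_ne_zero (NeZero.ne N)
  subst hn
  ext i j
  simp only [laplaceP, Matrix.of_apply, Matrix.circulant_apply, lapPCol]
  have e0 : ((i : ℕ) = j) ↔ i - j = 0 := by rw [sub_eq_zero, Fin.ext_iff]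
  have e1 : ((j : ℕ) = i + 1 ∨ ((i : ℕ) + 1 = n + 1 ∧ (j : ℕ) = 0)) ↔ i - j = -1 := by
    rw [fin_sub_eq_neg_one_iff, fin_eq_add_one_iff]
  have e2 : ((i : ℕ) = j + 1 ∨ ((j : ℕ) + 1 = n + 1 ∧ (i : ℕ) = 0)) ↔ i - j = 1 := by
    rw [fin_sub_eq_one_iff', fin_eq_add_one_iff]
  simp only [e0, e1, e2]
  split_ifs <;> norm_num

/-- The periodic three-point stencil: `(Δ w)_i = 2w_i − w_{i+1} − w_{i−1}` (indices mod `N`).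
[cite: VysotskyRakhuba2022, §5.3; PlonkaHoffmannWeickert2016, Thm. 2.2 (proof)] -/
theorem circulant_lapPCol_mulVec {N : ℕ} [NeZero N] (w : Fin N → K) (i : Fin N) :
    (Matrix.circulant (lapPCol K N) *ᵥ w) i = 2 * w i - w (i + 1) - w (i - 1) := by
  simp only [Matrix.mulVec, dotProduct, Matrix.circulant_apply, lapPCol, sub_mul, ite_mul,
    zero_mul, one_mul, Finset.sum_sub_distrib]
  simp_rw [sub_eq_zero, fin_sub_eq_one_iff, fin_sub_eq_neg_one_iff, Finset.sum_ite_eq,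
    Finset.mem_univ, if_true]
  ring

/-- `(Δ w)_i`, stated for `laplaceP`.  [cite: VysotskyRakhuba2022, §5.3] -/
theorem laplaceP_mulVec_apply {N : ℕ} [NeZero N] (w : Fin N → K) (i : Fin N) :
    (laplaceP K N *ᵥ w) i = 2 * w i - w (i + 1) - w (i - 1) := by
  rw [laplaceP_eq_circulant, circulant_lapPCol_mulVec]

/-- `Σ_d (2e₀ − e₁ − e₋₁)_d = 0`: the row and column sums of `Δ` vanish.
[cite: PlonkaHoffmannWeickert2016, §2 (ii)] -/
theorem sum_lapPCol (N : ℕ) [NeZero N] : ∑ d, lapPCol K N d = 0 := by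
  simp only [lapPCol, Finset.sum_sub_distrib, Finset.sum_ite_eq', Finset.mem_univ, if_true]
  ring

/-- Hypothesis (ii) of [PHW16, §2] for `Δ`: "`A 𝟙 = 0`".
[cite: PlonkaHoffmannWeickert2016, §2 (ii), Thm. 2.2] -/
theorem laplaceP_mulVec_one (N : ℕ) : laplaceP K N *ᵥ 1 = 0 := by
  rcases Nat.eq_zero_or_pos N with rfl | hN
  · ext i; exact Fin.elim0 i
  haveI : NeZero N := ⟨hN.ne'⟩
  ext i
  rw [laplaceP_mulVec_apply]
  simp; ring

/-- `J Δ = 0` (column sums of `Δ` vanish).  [cite: PlonkaHoffmannWeickert2016, Thm. 2.1 (proof,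
`J L = 0`), Thm. 2.2] -/
theorem ones_mul_laplaceP (N : ℕ) : ones K (Fin N) * laplaceP K N = 0 := by
  rcases Nat.eq_zero_or_pos N with rfl | hN
  · ext i; exact Fin.elim0 i
  haveI : NeZero N := ⟨hN.ne'⟩
  rw [laplaceP_eq_circulant, ones_mul_circulant, sum_lapPCol, zero_smul]

/-- `Δ J = 0` (row sums of `Δ` vanish).  [cite: PlonkaHoffmannWeickert2016, Thm. 2.1 (proof,
`L J = 0`), Thm. 2.2] -/
theorem laplaceP_mul_ones (N : ℕ) : laplaceP K N * ones K (Fin N) = 0 :=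
  mul_ones_eq_zero (laplaceP_mulVec_one N)

end Stencil

/-! ## H. PROPOSITION 5.2 of [VR22] = THEOREM 2.2 of [PHW16]: `Δ⁺ = circ(f)` -/

section Kernel

variable (K : Type*) [Field K] [CharZero K]

/-- The kernel `f(x) = (6x² − 6Nx + N² − 1)/(12N)` of [VR22, Prop. 5.2]
(`= −a⁺(x)`, `a⁺_j = (1 − N²)/(12N) + j(N − j)/(2N)` of [PHW16, Thm. 2.2]).
[cite: VysotskyRakhuba2022, Prop. 5.2; PlonkaHoffmannWeickert2016, Thm. 2.2] -/
def lapPinvFun (N : ℕ) (x : K) : K := (6 * x ^ 2 - 6 * N * x + (N : K) ^ 2 - 1) / (12 * N)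

/-- The first column `(f(0), f(1), …, f(N−1))` of `Δ⁺`.  [cite: VysotskyRakhuba2022, Prop. 5.2] -/
def lapPinvCol (N : ℕ) : Fin N → K := fun j => lapPinvFun K N (j : ℕ)

variable {K}

/-- The discrete equation behind Prop. 5.2 / Thm. 2.2: `2f(x) − f(x+1) − f(x−1) = −1/N`.
[cite: VysotskyRakhuba2022, Prop. 5.2 (proof via §5.3); PlonkaHoffmannWeickert2016, Thm. 2.2
(proof: `A A⁺ = I − J/N`)] -/
theorem lapPinvFun_stencil {N : ℕ} (hN : (N : K) ≠ 0) (x : K) :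
    2 * lapPinvFun K N x - lapPinvFun K N (x + 1) - lapPinvFun K N (x - 1) = -(N : K)⁻¹ := by
  unfold lapPinvFun
  field_simp
  ring

/-- Periodicity defect of the quadratic kernel: `f(x + N) = f(x) + x`; in particular
`f(N) = f(0)` and `f(N − 1) = f(−1) − 1` (the wrap-around rows of `Δ circ(f)`).
[cite: VysotskyRakhuba2022, Prop. 5.2; PlonkaHoffmannWeickert2016, Thm. 2.2 (proof)] -/
theorem lapPinvFun_add_natCast {N : ℕ} (hN : (N : K) ≠ 0) (x : K) :
    lapPinvFun K N (x + N) = lapPinvFun K N x + x := by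
  unfold lapPinvFun
  field_simp
  ring

/-- `f` evaluated along the cyclic successor: `f((i+1) mod N) = f(i + 1)`.
[cite: VysotskyRakhuba2022, Prop. 5.2] -/
theorem lapPinvCol_add_one {N : ℕ} [NeZero N] (hN : (N : K) ≠ 0) (i : Fin N) :
    lapPinvCol K N (i + 1) = lapPinvFun K N ((i : ℕ) + 1) := by
  obtain ⟨n, hn⟩ := Nat.exists_eq_succ_of_ne_zero (NeZero.ne N)
  subst hn
  unfold lapPinvCol
  rw [Fin.val_add_one]
  split_ifs with h
  · rw [h, Fin.val_last, Nat.cast_zero, ← zero_add ((n : K) + 1), ← Nat.cast_succ,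
      lapPinvFun_add_natCast hN, add_zero]
  · push_cast; rfl

/-- `f` evaluated along the cyclic predecessor: `f((i−1) mod N) = f(i − 1) − [i = 0]`.
[cite: VysotskyRakhuba2022, Prop. 5.2] -/
theorem lapPinvCol_sub_one {N : ℕ} [NeZero N] (hN : (N : K) ≠ 0) (i : Fin N) :
    lapPinvCol K N (i - 1) = lapPinvFun K N ((i : ℕ) - 1) - if i = 0 then 1 else 0 := by
  obtain ⟨n, hn⟩ := Nat.exists_eq_succ_of_ne_zero (NeZero.ne N)
  subst hn
  unfold lapPinvCol
  rw [Fin.coe_sub_one]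
  split_ifs with h
  · rw [h, Fin.val_zero, Nat.cast_zero, zero_sub]
    have : ((n : ℕ) : K) = -1 + ((n + 1 : ℕ) : K) := by push_cast; ring
    rw [this, lapPinvFun_add_natCast hN]
    ring
  · have h1 : 1 ≤ (i : ℕ) := Nat.one_le_iff_ne_zero.mpr fun h0 => h (Fin.ext h0)
    rw [Nat.cast_sub h1, Nat.cast_one, sub_zero]

/-- The key identity: `circ(2e₀ − e₁ − e₋₁) · (f(0), …, f(N−1))ᵀ = e₀ − 𝟙/N`, i.e. the columns of
`Δ circ(f)` are those of `I − J/N`.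
[cite: VysotskyRakhuba2022, Prop. 5.2; PlonkaHoffmannWeickert2016, Thm. 2.2 (proof)] -/
theorem circulant_lapPCol_mulVec_lapPinvCol {N : ℕ} [NeZero N] (hN : (N : K) ≠ 0) :
    Matrix.circulant (lapPCol K N) *ᵥ lapPinvCol K N = Pi.single 0 1 - fun _ => (N : K)⁻¹ := by
  ext i
  rw [circulant_lapPCol_mulVec, lapPinvCol_add_one hN, lapPinvCol_sub_one hN, Pi.sub_apply,
    Pi.single_apply]
  unfold lapPinvCol
  have h := lapPinvFun_stencil hN ((i : ℕ) : K)
  split_ifs <;> linear_combination h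

/-- `2 Σ_{j<N} j = N(N−1)`.  [folklore: power sums] -/
private theorem sum_range_natCast_mul_two (N : ℕ) :
    (∑ j ∈ Finset.range N, (j : K)) * 2 = N * (N - 1) := by
  induction N with
  | zero => simp
  | succ N ih => rw [Finset.sum_range_succ, add_mul, ih]; push_cast; ring

/-- `6 Σ_{j<N} j² = N(N−1)(2N−1)`.  [folklore: power sums] -/
private theorem sum_range_natCast_sq_mul_six (N : ℕ) :
    (∑ j ∈ Finset.range N, (j : K) ^ 2) * 6 = N * (N - 1) * (2 * N - 1) := by
  induction N with
  | zero => simp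
  | succ N ih => rw [Finset.sum_range_succ, add_mul, ih]; push_cast; ring

/-- `4 Σ_{j<N} j³ = N²(N−1)²`.  [folklore: power sums] -/
private theorem sum_range_natCast_cube_mul_four (N : ℕ) :
    (∑ j ∈ Finset.range N, (j : K) ^ 3) * 4 = (N : K) ^ 2 * (N - 1) ^ 2 := by
  induction N with
  | zero => simp
  | succ N ih => rw [Finset.sum_range_succ, add_mul, ih]; push_cast; ring

/-- `30 Σ_{j<N} j⁴ = N(N−1)(2N−1)(3N²−3N−1)` (Faulhaber).  [folklore: power sums] -/
private theorem sum_range_natCast_fourth_mul_thirty (N : ℕ) :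
    (∑ j ∈ Finset.range N, (j : K) ^ 4) * 30 =
      N * (N - 1) * (2 * N - 1) * (3 * (N : K) ^ 2 - 3 * N - 1) := by
  induction N with
  | zero => simp
  | succ N ih => rw [Finset.sum_range_succ, add_mul, ih]; push_cast; ring

/-- `Σ_{j<N} (6j² − 6Nj + N² − 1) = 0`: the entries of each column of `Δ⁺` sum to zero.
[cite: VysotskyRakhuba2022, Prop. 5.2; PlonkaHoffmannWeickert2016, Thm. 2.2 (proof,
`a⁺ᵀ 𝟙 = 0`)] -/
theorem sum_range_lapPinvNumerator (N : ℕ) :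
    ∑ j ∈ Finset.range N, (6 * (j : K) ^ 2 - 6 * N * j + (N : K) ^ 2 - 1) = 0 := by
  have h1 := sum_range_natCast_mul_two (K := K) N
  have h2 := sum_range_natCast_sq_mul_six (K := K) N
  simp only [Finset.sum_sub_distrib, Finset.sum_add_distrib, Finset.sum_const, Finset.card_range,
    ← Finset.mul_sum, nsmul_eq_mul, mul_one]
  linear_combination h2 - 3 * (N : K) * h1

/-- "`a⁺ᵀ 𝟙 = 0`": the column sums of `Δ⁺ = circ(f)` vanish, `Σ_j f(j) = 0`.
[cite: PlonkaHoffmannWeickert2016, Thm. 2.2 (proof); VysotskyRakhuba2022, Prop. 5.2] -/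
theorem sum_lapPinvCol (N : ℕ) : ∑ j, lapPinvCol K N j = 0 := by
  unfold lapPinvCol lapPinvFun
  rw [Fin.sum_univ_eq_sum_range (fun j => (6 * (j : K) ^ 2 - 6 * N * j + (N : K) ^ 2 - 1) /
    (12 * N)) N, ← Finset.sum_div, sum_range_lapPinvNumerator, zero_div]

end Kernel

section PseudoinverseLaplacian

variable (𝕜 : Type*) [RCLike 𝕜]

/-- `Δ circ(f) = I − J/N` [PHW16, proof of Thm. 2.2: "`A A⁺ = I − J/N`"].
[cite: PlonkaHoffmannWeickert2016, Thm. 2.2 (proof); VysotskyRakhuba2022, Prop. 5.2] -/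
theorem laplaceP_mul_circulant_lapPinvCol (N : ℕ) :
    laplaceP 𝕜 N * Matrix.circulant (lapPinvCol 𝕜 N) = 1 - (N : 𝕜)⁻¹ • ones 𝕜 (Fin N) := by
  rcases Nat.eq_zero_or_pos N with rfl | hpos
  · ext i; exact Fin.elim0 i
  haveI : NeZero N := ⟨hpos.ne'⟩
  have hN : (N : 𝕜) ≠ 0 := Nat.cast_ne_zero.mpr hpos.ne'
  rw [laplaceP_eq_circulant, Matrix.circulant_mul, circulant_lapPCol_mulVec_lapPinvCol hN,
    Matrix.circulant_sub, Matrix.circulant_single_one]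
  congr 1
  ext i j
  simp [Matrix.circulant_apply]

/-- `circ(f) Δ = I − J/N` (circulants commute).  [cite: PlonkaHoffmannWeickert2016, Thm. 2.2
(proof); VysotskyRakhuba2022, Prop. 5.2] -/
theorem circulant_lapPinvCol_mul_laplaceP (N : ℕ) :
    Matrix.circulant (lapPinvCol 𝕜 N) * laplaceP 𝕜 N = 1 - (N : 𝕜)⁻¹ • ones 𝕜 (Fin N) := by
  rcases Nat.eq_zero_or_pos N with rfl | hpos
  · ext i; exact Fin.elim0 i
  haveI : NeZero N := ⟨hpos.ne'⟩
  rw [← laplaceP_mul_circulant_lapPinvCol, laplaceP_eq_circulant, Matrix.Fin.circulant_mul_comm]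

/-- `I − J/N` is Hermitian (an orthogonal projector).  [cite: PlonkaHoffmannWeickert2016,
Thm. 2.1 (proof: third and fourth Penrose conditions)] -/
theorem isHermitian_one_sub_inv_smul_ones (n : Type*) [Fintype n] [DecidableEq n] (N : ℕ) :
    (1 - (N : 𝕜)⁻¹ • ones 𝕜 n : Matrix n n 𝕜).IsHermitian :=
  Matrix.isHermitian_one.sub (isHermitian_ones.smul (IsSelfAdjoint.natCast _).inv₀)

/-- PROPOSITION 5.2 of [VR22] / THEOREM 2.2 of [PHW16] (Penrose form): `circ(f)`,
`f(j) = (6j² − 6Nj + N² − 1)/(12N)`, satisfies the four Penrose equations for the periodic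
Laplacian `Δ = circ(2, −1, 0, …, 0, −1)` (all `N`; for `N ≤ 1` both sides are `0`).
[cite: VysotskyRakhuba2022, Prop. 5.2; PlonkaHoffmannWeickert2016, Thm. 2.2] -/
theorem isMoorePenroseInverse_laplaceP (N : ℕ) :
    IsMoorePenroseInverse (laplaceP 𝕜 N) (Matrix.circulant (lapPinvCol 𝕜 N)) := by
  have hLX := laplaceP_mul_circulant_lapPinvCol 𝕜 N
  have hXL := circulant_lapPinvCol_mul_laplaceP 𝕜 N
  have hP := isHermitian_one_sub_inv_smul_ones 𝕜 (Fin N) N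
  have hJX : ones 𝕜 (Fin N) * Matrix.circulant (lapPinvCol 𝕜 N) = 0 := by
    rw [ones_mul_circulant, sum_lapPinvCol, zero_smul]
  refine ⟨?_, ?_, ?_, ?_⟩
  · rw [hLX, sub_mul, one_mul, smul_mul_assoc, ones_mul_laplaceP, smul_zero, sub_zero]
  · rw [hXL, sub_mul, one_mul, smul_mul_assoc, hJX, smul_zero, sub_zero]
  · rw [hLX]; exact hP
  · rw [hXL]; exact hP

/-- PROPOSITION 5.2 of [VR22]: "the pseudoinverse of `Δ` is a circulant `Δ⁺` with elements
`(Δ⁺)_{ij} = f((i − j) mod N)`, `f(i) = (6i² − 6Ni + N² − 1)/(12N)`" — matrix form.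
[cite: VysotskyRakhuba2022, Prop. 5.2; PlonkaHoffmannWeickert2016, Thm. 2.2] -/
theorem pinv_laplaceP (N : ℕ) : pinv (laplaceP 𝕜 N) = Matrix.circulant (lapPinvCol 𝕜 N) :=
  (isMoorePenroseInverse_iff_eq_pinv.mp (isMoorePenroseInverse_laplaceP 𝕜 N)).symm

/-- PROPOSITION 5.2 of [VR22], entrywise: `(Δ⁺)_{ij} = f((i − j) mod N)` with
`f(i) = (6i² − 6Ni + N² − 1)/(12N)` (here `(i − j) mod N` is subtraction in `Fin N = ℤ/N`).
[cite: VysotskyRakhuba2022, Prop. 5.2] -/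
theorem pinv_laplaceP_apply {N : ℕ} (i j : Fin N) :
    pinv (laplaceP 𝕜 N) i j =
      (6 * (((i - j : Fin N) : ℕ) : 𝕜) ^ 2 - 6 * N * ((i - j : Fin N) : ℕ) + (N : 𝕜) ^ 2 - 1) /
        (12 * N) := by
  rw [pinv_laplaceP, Matrix.circulant_apply]; rfl

/-- THEOREM 2.2 of [PHW16], as printed, for `A = circ(−2, 1, 0, …, 1) = −Δ ∈ ℝ^{N×N}`:
"`A⁺ = circ(a⁺_0, a⁺_1, …, a⁺_{N−1})`, `a⁺_j = (1 − N²)/(12N) + j(N − j)/(2N)`" — here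
`(A⁺)_{ik} = a⁺_j` with `j = (i − k) mod N`.  [cite: PlonkaHoffmannWeickert2016, Thm. 2.2] -/
theorem pinv_neg_laplaceP_apply {N : ℕ} (i k : Fin N) :
    pinv (-laplaceP 𝕜 N) i k =
      (1 - (N : 𝕜) ^ 2) / (12 * N) +
        ((i - k : Fin N) : ℕ) * (N - ((i - k : Fin N) : ℕ)) / (2 * N) := by
  rcases Nat.eq_zero_or_pos N with rfl | hpos
  · exact Fin.elim0 i
  have hN : (N : 𝕜) ≠ 0 := Nat.cast_ne_zero.mpr hpos.ne'
  rw [pinv_neg, Matrix.neg_apply, pinv_laplaceP_apply]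
  field_simp
  ring

/-- "`A A⁺ = A⁺ A = I − J/N`" for the periodic Laplacian: `Δ Δ⁺ = I − J/N`.
[cite: PlonkaHoffmannWeickert2016, Thm. 2.1 (proof), Thm. 2.2; VysotskyRakhuba2022, Prop. 5.2] -/
theorem laplaceP_mul_pinv (N : ℕ) :
    laplaceP 𝕜 N * pinv (laplaceP 𝕜 N) = 1 - (N : 𝕜)⁻¹ • ones 𝕜 (Fin N) := by
  rw [pinv_laplaceP, laplaceP_mul_circulant_lapPinvCol]

/-- `Δ⁺ Δ = I − J/N`.  [cite: PlonkaHoffmannWeickert2016, Thm. 2.1 (proof), Thm. 2.2] -/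
theorem pinv_mul_laplaceP (N : ℕ) :
    pinv (laplaceP 𝕜 N) * laplaceP 𝕜 N = 1 - (N : 𝕜)⁻¹ • ones 𝕜 (Fin N) := by
  rw [pinv_laplaceP, circulant_lapPinvCol_mul_laplaceP]

/-- `J Δ⁺ = 0`: "`a⁺ᵀ 𝟙 = 0`", the columns of `Δ⁺` have mean zero.
[cite: PlonkaHoffmannWeickert2016, Thm. 2.2 (proof)] -/
theorem ones_mul_pinv_laplaceP (N : ℕ) : ones 𝕜 (Fin N) * pinv (laplaceP 𝕜 N) = 0 := by
  rw [pinv_laplaceP, ones_mul_circulant, sum_lapPinvCol, zero_smul]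

/-- The periodic discrete Poisson problem: for mean-zero data `g` (`Σ g = 0`), `u = Δ⁺ g` solves
`Δ u = g` ("since `L` is not invertible we apply the Moore–Penrose inverse of `L`", [PHW16, §3]).
[cite: PlonkaHoffmannWeickert2016, Thm. 2.1 (`L L⁺ = I − J/N`), §3] -/
theorem laplaceP_mulVec_pinv_mulVec {N : ℕ} {g : Fin N → 𝕜} (hg : ∑ j, g j = 0) :
    laplaceP 𝕜 N *ᵥ (pinv (laplaceP 𝕜 N) *ᵥ g) = g := by
  rw [Matrix.mulVec_mulVec, laplaceP_mul_pinv, Matrix.sub_mulVec, Matrix.one_mulVec,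
    Matrix.smul_mulVec, ones_mulVec, hg]
  ext i; simp

end PseudoinverseLaplacian

/-! ## I. THEOREM 2.3 of [PHW16]: the biharmonic case `(Δ²)⁺ = circ(quartic)` -/

section Biharmonic

variable (K : Type*) [Field K] [CharZero K]

/-- The quartic kernel of `(Δ²)⁺`: `g(x) = (N² − 1)(N² + 11)/(720N) − x(N − x)(Nx − x² + 2)/(24N)`
(`= −c⁺_x` of [PHW16, Thm. 2.3], where `L = −A² = −Δ²`).
[cite: PlonkaHoffmannWeickert2016, Thm. 2.3] -/
def biLapPinvFun (N : ℕ) (x : K) : K :=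
  ((N : K) ^ 2 - 1) * ((N : K) ^ 2 + 11) / (720 * N) - x * (N - x) * (N * x - x ^ 2 + 2) / (24 * N)

/-- The first column `(g(0), …, g(N−1))` of `(Δ²)⁺`.
[cite: PlonkaHoffmannWeickert2016, Thm. 2.3] -/
def biLapPinvCol (N : ℕ) : Fin N → K := fun j => biLapPinvFun K N (j : ℕ)

variable {K}

/-- `2g(x) − g(x+1) − g(x−1) = f(x)`: the second difference of the quartic kernel is the quadratic
kernel, i.e. `Δ circ(g) = circ(f) = Δ⁺`.  [cite: PlonkaHoffmannWeickert2016, Thm. 2.3 (proof)] -/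
theorem biLapPinvFun_stencil {N : ℕ} (hN : (N : K) ≠ 0) (x : K) :
    2 * biLapPinvFun K N x - biLapPinvFun K N (x + 1) - biLapPinvFun K N (x - 1) =
      lapPinvFun K N x := by
  unfold biLapPinvFun lapPinvFun
  field_simp
  ring

/-- No wrap-around defect for the quartic kernel: `g(N) = g(0)`.
[cite: PlonkaHoffmannWeickert2016, Thm. 2.3 (proof)] -/
theorem biLapPinvFun_natCast (N : ℕ) : biLapPinvFun K N N = biLapPinvFun K N 0 := by
  unfold biLapPinvFun; ring

/-- No wrap-around defect for the quartic kernel: `g(N − 1) = g(−1)`.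
[cite: PlonkaHoffmannWeickert2016, Thm. 2.3 (proof)] -/
theorem biLapPinvFun_natCast_sub_one (N : ℕ) :
    biLapPinvFun K N ((N : K) - 1) = biLapPinvFun K N (-1) := by
  unfold biLapPinvFun; ring

/-- `g((i+1) mod N) = g(i + 1)`.  [cite: PlonkaHoffmannWeickert2016, Thm. 2.3 (proof)] -/
theorem biLapPinvCol_add_one {N : ℕ} [NeZero N] (i : Fin N) :
    biLapPinvCol K N (i + 1) = biLapPinvFun K N ((i : ℕ) + 1) := by
  obtain ⟨n, hn⟩ := Nat.exists_eq_succ_of_ne_zero (NeZero.ne N)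
  subst hn
  unfold biLapPinvCol
  rw [Fin.val_add_one]
  split_ifs with h
  · rw [h, Fin.val_last, Nat.cast_zero, ← Nat.cast_succ, biLapPinvFun_natCast]
  · push_cast; rfl

/-- `g((i−1) mod N) = g(i − 1)`.  [cite: PlonkaHoffmannWeickert2016, Thm. 2.3 (proof)] -/
theorem biLapPinvCol_sub_one {N : ℕ} [NeZero N] (i : Fin N) :
    biLapPinvCol K N (i - 1) = biLapPinvFun K N ((i : ℕ) - 1) := by
  obtain ⟨n, hn⟩ := Nat.exists_eq_succ_of_ne_zero (NeZero.ne N)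
  subst hn
  unfold biLapPinvCol
  rw [Fin.coe_sub_one]
  split_ifs with h
  · rw [h, Fin.val_zero, Nat.cast_zero, zero_sub]
    have : ((n : ℕ) : K) = ((n + 1 : ℕ) : K) - 1 := by push_cast; ring
    rw [this, biLapPinvFun_natCast_sub_one]
  · have h1 : 1 ≤ (i : ℕ) := Nat.one_le_iff_ne_zero.mpr fun h0 => h (Fin.ext h0)
    rw [Nat.cast_sub h1, Nat.cast_one]

/-- `circ(2e₀ − e₁ − e₋₁) · (g(0), …, g(N−1))ᵀ = (f(0), …, f(N−1))ᵀ`, i.e. `Δ circ(g) = circ(f)`.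
[cite: PlonkaHoffmannWeickert2016, Thm. 2.3 (proof)] -/
theorem circulant_lapPCol_mulVec_biLapPinvCol {N : ℕ} [NeZero N] (hN : (N : K) ≠ 0) :
    Matrix.circulant (lapPCol K N) *ᵥ biLapPinvCol K N = lapPinvCol K N := by
  ext i
  rw [circulant_lapPCol_mulVec, biLapPinvCol_add_one, biLapPinvCol_sub_one]
  exact biLapPinvFun_stencil hN _

/-- `Σ_{j<N} g(j) = 0`: the columns of `(Δ²)⁺` have mean zero ("`c⁺ᵀ 𝟙 = 0`").
[cite: PlonkaHoffmannWeickert2016, Thm. 2.3 (proof)] -/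
theorem sum_biLapPinvCol (N : ℕ) : ∑ j, biLapPinvCol K N j = 0 := by
  rcases Nat.eq_zero_or_pos N with rfl | hpos
  · simp
  have hN : (N : K) ≠ 0 := Nat.cast_ne_zero.mpr hpos.ne'
  have h1 := sum_range_natCast_mul_two (K := K) N
  have h2 := sum_range_natCast_sq_mul_six (K := K) N
  have h3 := sum_range_natCast_cube_mul_four (K := K) N
  have h4 := sum_range_natCast_fourth_mul_thirty (K := K) N
  have hu : (∑ j ∈ Finset.range N, (j : K) * (N - j) * (N * j - (j : K) ^ 2 + 2)) * 30 =
      N * ((N : K) ^ 2 - 1) * ((N : K) ^ 2 + 11) := by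
    rw [Finset.sum_congr rfl fun (j : ℕ) _ =>
      show (j : K) * (N - j) * (N * j - (j : K) ^ 2 + 2) =
        (j : K) ^ 4 - 2 * N * (j : K) ^ 3 + ((N : K) ^ 2 - 2) * (j : K) ^ 2 + 2 * N * j by ring]
    simp only [Finset.sum_add_distrib, Finset.sum_sub_distrib, ← Finset.mul_sum]
    linear_combination h4 - 15 * (N : K) * h3 + 5 * ((N : K) ^ 2 - 2) * h2 + 30 * (N : K) * h1
  have hu' : ∑ j ∈ Finset.range N, (j : K) * (N - j) * (N * j - (j : K) ^ 2 + 2) =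
      N * ((N : K) ^ 2 - 1) * ((N : K) ^ 2 + 11) / 30 := by
    rw [eq_div_iff (by norm_num : (30 : K) ≠ 0)]
    exact hu
  unfold biLapPinvCol biLapPinvFun
  rw [Fin.sum_univ_eq_sum_range (fun j => ((N : K) ^ 2 - 1) * ((N : K) ^ 2 + 11) / (720 * N) -
    (j : K) * (N - j) * (N * j - (j : K) ^ 2 + 2) / (24 * N)) N]
  rw [Finset.sum_sub_distrib, Finset.sum_const, Finset.card_range, ← Finset.sum_div, nsmul_eq_mul,
    hu']
  field_simp
  ring

variable (𝕜 : Type*) [RCLike 𝕜]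

/-- `Δ circ(g) = Δ⁺`.  [cite: PlonkaHoffmannWeickert2016, Thm. 2.3 (proof)] -/
theorem laplaceP_mul_circulant_biLapPinvCol (N : ℕ) :
    laplaceP 𝕜 N * Matrix.circulant (biLapPinvCol 𝕜 N) = pinv (laplaceP 𝕜 N) := by
  rcases Nat.eq_zero_or_pos N with rfl | hpos
  · ext i; exact Fin.elim0 i
  haveI : NeZero N := ⟨hpos.ne'⟩
  have hN : (N : 𝕜) ≠ 0 := Nat.cast_ne_zero.mpr hpos.ne'
  rw [pinv_laplaceP, laplaceP_eq_circulant, Matrix.circulant_mul,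
    circulant_lapPCol_mulVec_biLapPinvCol hN]

/-- `(Δ⁺)² = circ(g)`: the square of the quadratic-kernel circulant is the quartic-kernel
circulant.  [cite: PlonkaHoffmannWeickert2016, Thm. 2.3 (proof)] -/
theorem pinv_laplaceP_mul_self (N : ℕ) :
    pinv (laplaceP 𝕜 N) * pinv (laplaceP 𝕜 N) = Matrix.circulant (biLapPinvCol 𝕜 N) := by
  have hJY : ones 𝕜 (Fin N) * Matrix.circulant (biLapPinvCol 𝕜 N) = 0 := by
    rw [ones_mul_circulant, sum_biLapPinvCol, zero_smul]
  have h1 : (1 : Matrix (Fin N) (Fin N) 𝕜) =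
      pinv (laplaceP 𝕜 N) * laplaceP 𝕜 N + (N : 𝕜)⁻¹ • ones 𝕜 (Fin N) := by
    rw [pinv_mul_laplaceP, sub_add_cancel]
  calc pinv (laplaceP 𝕜 N) * pinv (laplaceP 𝕜 N)
      = pinv (laplaceP 𝕜 N) * (laplaceP 𝕜 N * Matrix.circulant (biLapPinvCol 𝕜 N)) := by
        rw [laplaceP_mul_circulant_biLapPinvCol]
    _ = (1 - (N : 𝕜)⁻¹ • ones 𝕜 (Fin N)) * Matrix.circulant (biLapPinvCol 𝕜 N) := by
        rw [← Matrix.mul_assoc, pinv_mul_laplaceP]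
    _ = Matrix.circulant (biLapPinvCol 𝕜 N) := by
        rw [sub_mul, one_mul, smul_mul_assoc, hJY, smul_zero, sub_zero]

/-- THEOREM 2.3 of [PHW16] (Penrose form): `circ(g)` is the Moore–Penrose inverse of the
biharmonic matrix `Δ² = (−A)²`.  [cite: PlonkaHoffmannWeickert2016, Thm. 2.3] -/
theorem isMoorePenroseInverse_laplaceP_sq (N : ℕ) :
    IsMoorePenroseInverse (laplaceP 𝕜 N * laplaceP 𝕜 N) (Matrix.circulant (biLapPinvCol 𝕜 N)) := by
  rw [← pinv_laplaceP_mul_self]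
  refine isMoorePenroseInverse_mul_self_of_commute (isMoorePenroseInverse_pinv _) ?_
  rw [laplaceP_mul_pinv, pinv_mul_laplaceP]

/-- THEOREM 2.3 of [PHW16]: `(Δ²)⁺ = circ(g(0), …, g(N−1))`,
`g(k) = (N² − 1)(N² + 11)/(720N) − k(N − k)(Nk − k² + 2)/(24N)`.
[cite: PlonkaHoffmannWeickert2016, Thm. 2.3] -/
theorem pinv_laplaceP_sq (N : ℕ) :
    pinv (laplaceP 𝕜 N * laplaceP 𝕜 N) = Matrix.circulant (biLapPinvCol 𝕜 N) :=
  (isMoorePenroseInverse_iff_eq_pinv.mp (isMoorePenroseInverse_laplaceP_sq 𝕜 N)).symm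

/-- THEOREM 2.3 of [PHW16], as printed, for "`L := −A²`" (`A = −Δ`, so `L = −Δ²`):
"`L⁺ = circ(c⁺_0, …, c⁺_{N−1})`, `c⁺_k = (1 − N²)(N² + 11)/(720N) + k(N − k)(Nk − k² + 2)/(24N)`",
with `k = (i − j) mod N`.  [cite: PlonkaHoffmannWeickert2016, Thm. 2.3] -/
theorem pinv_neg_laplaceP_sq_apply {N : ℕ} (i j : Fin N) :
    pinv (-(laplaceP 𝕜 N * laplaceP 𝕜 N)) i j =
      (1 - (N : 𝕜) ^ 2) * ((N : 𝕜) ^ 2 + 11) / (720 * N) +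
        ((i - j : Fin N) : ℕ) * (N - ((i - j : Fin N) : ℕ)) *
          (N * ((i - j : Fin N) : ℕ) - (((i - j : Fin N) : ℕ) : 𝕜) ^ 2 + 2) / (24 * N) := by
  rw [pinv_neg, Matrix.neg_apply, pinv_laplaceP_sq, Matrix.circulant_apply]
  unfold biLapPinvCol biLapPinvFun
  ring

end Biharmonic

/-! ## J. COROLLARY 5.2 of [VR22]: QTT ranks of `Δ⁺` do not exceed `4` -/

section QTT

variable (𝕜 : Type*) [RCLike 𝕜]

/-- The quadratic kernel as a polynomial of degree `≤ 2`.  [cite: VysotskyRakhuba2022, Prop. 5.2,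
Cor. 5.2 (proof: Cor. 3.2 with `s = 1`, `z₁ = 1`, `p₁ = 2`)] -/
noncomputable def lapPinvPoly (N : ℕ) : 𝕜[X] :=
  C (12 * (N : 𝕜))⁻¹ * (C 6 * X ^ 2 - C (6 * (N : 𝕜)) * X + C ((N : 𝕜) ^ 2 - 1))

/-- `f(x) = P(x)` for the kernel polynomial `P`.  [cite: VysotskyRakhuba2022, Cor. 5.2 (proof)] -/
theorem eval_lapPinvPoly (N : ℕ) (x : 𝕜) : (lapPinvPoly 𝕜 N).eval x = lapPinvFun 𝕜 N x := by
  simp only [lapPinvPoly, lapPinvFun, eval_mul, eval_C, eval_sub, eval_add, eval_pow, eval_X]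
  rw [div_eq_inv_mul]
  ring

/-- `deg P ≤ 2`.  [cite: VysotskyRakhuba2022, Cor. 5.2 (proof)] -/
theorem natDegree_lapPinvPoly_le (N : ℕ) : (lapPinvPoly 𝕜 N).natDegree ≤ 2 := by
  unfold lapPinvPoly
  compute_degree

/-- COROLLARY 5.2 of [VR22]: "for any positive integer `L` the QTT ranks of the pseudoinverse `Δ⁺`
of the stiffness matrix `Δ ∈ ℝ^{b^L × b^L}` do not exceed `4`" — rank form: every QTT unfolding
matrix of `Δ⁺` has rank `≤ 4` (any base `b`, any `RCLike` field).
[cite: VysotskyRakhuba2022, Cor. 5.2] -/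
theorem rank_qttUnfolding_pinv_laplaceP_le (b L l m : ℕ) (h : l + m = L) :
    (qttUnfolding (pinv (laplaceP 𝕜 (b ^ L))) l m h).rank ≤ 4 := by
  have hmain := rank_qttUnfolding_circulant_expPoly_le (K := 𝕜) (s := 1) (fun _ => (1 : 𝕜))
    (fun _ => one_ne_zero) (fun _ => 2) (fun _ => lapPinvPoly 𝕜 (b ^ L))
    (fun _ => natDegree_lapPinvPoly_le 𝕜 (b ^ L)) (fun i : ℤ => lapPinvFun 𝕜 (b ^ L) (i : 𝕜))
    (fun i => by simp [eval_lapPinvPoly]) b l m h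
  have hcol : Matrix.circulant (lapPinvCol 𝕜 (b ^ L)) =
      Matrix.circulant (fun j : Fin (b ^ L) => (fun i : ℤ => lapPinvFun 𝕜 (b ^ L) (i : 𝕜)) j) :=
    congrArg Matrix.circulant (funext fun j => by simp only [lapPinvCol, Int.cast_natCast])
  rw [pinv_laplaceP, hcol]
  exact hmain.trans (by simp)

/-- COROLLARY 5.2 of [VR22], tensor-train form over `ℝ`: `Δ⁺ ∈ ℝ^{b^L × b^L}` is the matrix of
an explicit QTT train with boundary ranks `1` and all interior ranks `≤ 4`.
[cite: VysotskyRakhuba2022, Cor. 5.2] -/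
theorem exists_qttMatrix_pinv_laplaceP (b L : ℕ) :
    ∃ T : TensorTrain ℝ (Fin b × Fin b) L,
      T.qttMatrix = pinv (laplaceP ℝ (b ^ L)) ∧ T.r 0 = 1 ∧ (0 < L → T.r L = 1) ∧
        ∀ k, 0 < k → k < L → T.r k ≤ 4 := by
  obtain ⟨T, hT, h0, hL, hk⟩ := exists_qttMatrix_eq_circulant_expPoly (s := 1)
    (fun _ => (1 : ℝ)) (fun _ => one_ne_zero) (fun _ => 2)
    (fun _ => lapPinvPoly ℝ (b ^ L)) (fun _ => natDegree_lapPinvPoly_le ℝ (b ^ L))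
    (fun i : ℤ => lapPinvFun ℝ (b ^ L) (i : ℝ)) (fun i => by simp [eval_lapPinvPoly]) b L
  refine ⟨T, ?_, h0, hL, fun k hk0 hkL => (hk k hk0 hkL).trans (by simp)⟩
  rw [hT, pinv_laplaceP]
  exact congrArg Matrix.circulant (funext fun j => rfl)

end QTT

section NeumannLaplacian

/-! ### K. THEOREM 2.5 of [PHW16]: the pseudoinverse of the Neumann Laplacian `Δ_NN = −B`,
`B = tridiag(1, −2, 1)` with the two corner diagonal entries `−1` (eq. (2.2) of [PHW16]) -/

variable (K : Type*) [Field K] [CharZero K]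

/-- The kernel of THEOREM 2.5 of [PHW16] (negated, since `Δ_NN = −B`, and written symmetrically
as a function of two integers):
`g_N(i, j) = (N−1)(2N−1)/(6N) + (i(i+1) + j(j+1))/(2N) − max(i, j)`; for `j ≥ k`,
`−g_N(j, k) = b⁺_{j,k} = −(N−1)(2N−1)/(6N) + j − j(j+1)/(2N) − k(k+1)/(2N)` is PHW's entry of
`B⁺`.  [cite: PlonkaHoffmannWeickert2016, Thm. 2.5] -/
def lapNNPinvFun (N : ℕ) (i j : ℤ) : K :=
  ((N : K) - 1) * (2 * N - 1) / (6 * N) + ((i : K) * (i + 1) + j * (j + 1)) / (2 * N) -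
    (if i ≤ j then (j : K) else i)

/-- The matrix `(g_N(i, j))_{i,j<N}` — by Theorem 2.5 the pseudoinverse of `Δ_NN`
(`pinv_laplaceNN`).  [cite: PlonkaHoffmannWeickert2016, Thm. 2.5] -/
def lapNNPinv (N : ℕ) : Matrix (Fin N) (Fin N) K :=
  Matrix.of fun i j => lapNNPinvFun K N ((i : ℕ) : ℤ) ((j : ℕ) : ℤ)

variable {K}

/-- `g_N` is symmetric.  [cite: PlonkaHoffmannWeickert2016, Thm. 2.5] -/
theorem lapNNPinvFun_comm (N : ℕ) (i j : ℤ) : lapNNPinvFun K N i j = lapNNPinvFun K N j i := by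
  unfold lapNNPinvFun
  rcases lt_trichotomy i j with h | rfl | h
  · rw [if_pos h.le, if_neg (not_le.mpr h)]; ring
  · rfl
  · rw [if_neg (not_le.mpr h), if_pos h.le]; ring

variable (K) in
/-- "`B⁺` is a symmetric matrix".  [cite: PlonkaHoffmannWeickert2016, Thm. 2.5] -/
theorem transpose_lapNNPinv (N : ℕ) : (lapNNPinv K N)ᵀ = lapNNPinv K N := by
  ext i j
  simp only [Matrix.transpose_apply, lapNNPinv, Matrix.of_apply]
  exact lapNNPinvFun_comm N _ _

/-- The free three-point stencil of `g_N(·, k)`: `2g(i,k) − g(i−1,k) − g(i+1,k) = δ_{ik} − 1/N`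
for all integers `i, k` (the quadratic part contributes `−1/N`, the kink of `−max(i, k)` at
`i = k` contributes `δ_{ik}`).  [cite: PlonkaHoffmannWeickert2016, Thm. 2.5 (proof)] -/
theorem lapNNPinvFun_stencil {N : ℕ} (hN : (N : K) ≠ 0) (i k : ℤ) :
    2 * lapNNPinvFun K N i k - lapNNPinvFun K N (i - 1) k - lapNNPinvFun K N (i + 1) k =
      (if i = k then 1 else 0) - (N : K)⁻¹ := by
  unfold lapNNPinvFun
  rcases lt_trichotomy i k with h | rfl | h
  · rw [if_pos h.le, if_pos (by omega : i - 1 ≤ k), if_pos (by omega : i + 1 ≤ k), if_neg h.ne]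
    push_cast; field_simp; ring
  · rw [if_pos le_rfl, if_pos (by omega : i - 1 ≤ i), if_neg (by omega : ¬ i + 1 ≤ i), if_pos rfl]
    push_cast; field_simp; ring
  · rw [if_neg (not_le.mpr h), if_neg (by omega : ¬ i + 1 ≤ k), if_neg h.ne']
    by_cases h1 : i - 1 ≤ k
    · rw [if_pos h1]; obtain rfl : i = k + 1 := by omega
      push_cast; field_simp; ring
    · rw [if_neg h1]; push_cast; field_simp; ring

/-- Reflection at the left end: `g_N(−1, k) = g_N(0, k)` for `k ≥ 0` (the ghost value of the
homogeneous Neumann condition).  [cite: PlonkaHoffmannWeickert2016, Thm. 2.5 (proof)] -/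
theorem lapNNPinvFun_neg_one (N : ℕ) {k : ℤ} (hk : 0 ≤ k) :
    lapNNPinvFun K N (-1) k = lapNNPinvFun K N 0 k := by
  unfold lapNNPinvFun
  rw [if_pos (by omega : (-1 : ℤ) ≤ k), if_pos hk]; push_cast; ring

/-- Reflection at the right end: `g_N(N, k) = g_N(N − 1, k)` for `k < N`.
[cite: PlonkaHoffmannWeickert2016, Thm. 2.5 (proof)] -/
theorem lapNNPinvFun_natCast {N : ℕ} (hN : (N : K) ≠ 0) {k : ℤ} (hk : k < N) :
    lapNNPinvFun K N N k = lapNNPinvFun K N ((N : ℤ) - 1) k := by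
  unfold lapNNPinvFun
  rw [if_neg (by omega : ¬ (N : ℤ) ≤ k)]
  by_cases h : (N : ℤ) - 1 ≤ k
  · rw [if_pos h]; obtain rfl : k = N - 1 := by omega
    push_cast; field_simp; ring
  · rw [if_neg h]; push_cast; field_simp; ring

/-- Row `i` of `Δ_NN` against a column `j ↦ G(j)`: the NEUMANN STENCIL
`2G(i) − G(i−1) − G(i+1)` with the ghost values `G(−1) := G(0)`, `G(N) := G(N−1)` (reflecting
boundary conditions).
[cite: PlonkaHoffmannWeickert2016, §2 eq. (2.2); KazeevKhoromskij2012, eq. (4)] -/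
theorem sum_laplaceNN_mul {R : Type*} [CommRing R] {N : ℕ} (i : Fin N) (G : ℤ → R) :
    ∑ j : Fin N, laplaceNN R N i j * G ((j : ℕ) : ℤ) =
      2 * G ((i : ℕ) : ℤ) - (if (i : ℕ) = 0 then G ((i : ℕ) : ℤ) else G (((i : ℕ) : ℤ) - 1)) -
        (if (i : ℕ) + 1 = N then G ((i : ℕ) : ℤ) else G (((i : ℕ) : ℤ) + 1)) := by
  set a : ℕ := (i : ℕ) with ha
  have haN : a < N := i.isLt
  set d : R := 2 - (if a = 0 then 1 else 0) - (if a + 1 = N then 1 else 0) with hd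
  set F : ℕ → R := fun x =>
    (if a = x then d else if x = a + 1 ∨ a = x + 1 then -1 else 0) * G (x : ℤ) with hF
  rw [show (∑ j : Fin N, laplaceNN R N i j * G ((j : ℕ) : ℤ)) = ∑ j : Fin N, F (j : ℕ) from rfl,
    Fin.sum_univ_eq_sum_range]
  have hsplit : ∀ x ∈ Finset.range N, F x =
      (if x = a then d * G (x : ℤ) else 0) -
        ((if x = a + 1 then G (x : ℤ) else 0) + (if x + 1 = a then G (x : ℤ) else 0)) := by
    intro x _
    simp only [hF]
    split_ifs <;> first | ring1 | omega
  rw [Finset.sum_congr rfl hsplit, Finset.sum_sub_distrib, Finset.sum_add_distrib,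
    Finset.sum_ite_eq' (Finset.range N), if_pos (Finset.mem_range.mpr haN),
    Finset.sum_ite_eq' (Finset.range N)]
  have h3 : (∑ x ∈ Finset.range N, if x + 1 = a then G (x : ℤ) else 0) =
      if a = 0 then 0 else G ((a : ℤ) - 1) := by
    split_ifs with h0
    · exact Finset.sum_eq_zero fun x _ => by rw [if_neg (by omega)]
    · rw [show ((a : ℤ) - 1) = ((a - 1 : ℕ) : ℤ) by omega]
      refine (Finset.sum_congr rfl fun x _ => ?_).trans
        ((Finset.sum_ite_eq' (Finset.range N) (a - 1) (fun x => G (x : ℤ))).trans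
          (if_pos (Finset.mem_range.mpr (by omega))))
      by_cases hx : x + 1 = a
      · rw [if_pos hx, if_pos (by omega)]
      · rw [if_neg hx, if_neg (by omega)]
  rw [h3]
  simp only [Finset.mem_range, hd]
  push_cast
  split_ifs <;> first | ring1 | omega

/-- `Δ_NN` is symmetric.  [cite: KazeevKhoromskij2012, eq. (4)] -/
theorem transpose_laplaceNN (R : Type*) [CommRing R] (N : ℕ) :
    (laplaceNN R N)ᵀ = laplaceNN R N := by
  ext i j
  simp only [laplaceNN, Matrix.transpose_apply, Matrix.of_apply]
  by_cases h : (i : ℕ) = j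
  · rw [if_pos h, if_pos h.symm, Fin.ext h]
  · rw [if_neg h, if_neg (Ne.symm h)]
    simp only [or_comm]

/-- `Δ_NN 𝟙 = 0` (hypothesis (ii) of [PHW16, §2] for `B`).
[cite: PlonkaHoffmannWeickert2016, §2 (ii)] -/
theorem laplaceNN_mulVec_one (R : Type*) [CommRing R] (N : ℕ) : laplaceNN R N *ᵥ 1 = 0 := by
  ext i
  have h := sum_laplaceNN_mul i (fun _ => (1 : R))
  simp only [mul_one, ite_self] at h
  simp only [Matrix.mulVec, dotProduct, Pi.one_apply, mul_one, Pi.zero_apply, h]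
  ring

/-- `Δ_NN J = 0`.  [cite: PlonkaHoffmannWeickert2016, §2 (ii), Thm. 2.1 (proof)] -/
theorem laplaceNN_mul_ones (R : Type*) [CommRing R] (N : ℕ) :
    laplaceNN R N * ones R (Fin N) = 0 :=
  mul_ones_eq_zero (laplaceNN_mulVec_one R N)

/-- `J Δ_NN = 0`.  [cite: PlonkaHoffmannWeickert2016, §2 (ii), Thm. 2.1 (proof)] -/
theorem ones_mul_laplaceNN (R : Type*) [CommRing R] (N : ℕ) :
    ones R (Fin N) * laplaceNN R N = 0 := by
  have h := congrArg Matrix.transpose (laplaceNN_mul_ones R N)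
  rwa [Matrix.transpose_mul, transpose_ones, transpose_laplaceNN, Matrix.transpose_zero] at h

variable (K) in
/-- THE KEY IDENTITY behind Theorem 2.5: `Δ_NN (g_N(i,j))_{ij} = I − J/N`.
[cite: PlonkaHoffmannWeickert2016, Thm. 2.5 (proof), Thm. 2.1 (proof)] -/
theorem laplaceNN_mul_lapNNPinv (N : ℕ) :
    laplaceNN K N * lapNNPinv K N = 1 - (N : K)⁻¹ • ones K (Fin N) := by
  ext i k
  have hN : (N : K) ≠ 0 := Nat.cast_ne_zero.mpr (Fin.pos i).ne'
  rw [Matrix.mul_apply]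
  simp only [lapNNPinv, Matrix.of_apply]
  rw [sum_laplaceNN_mul i (fun x => lapNNPinvFun K N x ((k : ℕ) : ℤ))]
  have h1 : (if (i : ℕ) = 0 then lapNNPinvFun K N ((i : ℕ) : ℤ) ((k : ℕ) : ℤ)
      else lapNNPinvFun K N (((i : ℕ) : ℤ) - 1) ((k : ℕ) : ℤ)) =
        lapNNPinvFun K N (((i : ℕ) : ℤ) - 1) ((k : ℕ) : ℤ) := by
    split_ifs with h0
    · rw [h0]; exact (lapNNPinvFun_neg_one N (by omega)).symm
    · rfl
  have h2 : (if (i : ℕ) + 1 = N then lapNNPinvFun K N ((i : ℕ) : ℤ) ((k : ℕ) : ℤ)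
      else lapNNPinvFun K N (((i : ℕ) : ℤ) + 1) ((k : ℕ) : ℤ)) =
        lapNNPinvFun K N (((i : ℕ) : ℤ) + 1) ((k : ℕ) : ℤ) := by
    split_ifs with h0
    · have hi : ((i : ℕ) : ℤ) = (N : ℤ) - 1 := by omega
      rw [hi, sub_add_cancel]
      exact (lapNNPinvFun_natCast hN (by have := k.isLt; omega)).symm
    · rfl
  rw [h1, h2, lapNNPinvFun_stencil hN, Matrix.sub_apply, Matrix.one_apply, Matrix.smul_apply,
    ones_apply, smul_eq_mul, mul_one]
  by_cases hik : i = k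
  · subst hik; simp
  · rw [if_neg hik, if_neg (by rw [Nat.cast_inj]; exact Fin.val_ne_of_ne hik)]

/-- The column sums of `(g_N(i,j))` vanish: `Σ_{i<N} g_N(i, k) = 0`, i.e. `J B⁺ = 0`.
[cite: PlonkaHoffmannWeickert2016, Thm. 2.5 (proof)] -/
theorem sum_lapNNPinvFun {N : ℕ} (k : Fin N) :
    ∑ i : Fin N, lapNNPinvFun K N ((i : ℕ) : ℤ) ((k : ℕ) : ℤ) = 0 := by
  have hN : (N : K) ≠ 0 := Nat.cast_ne_zero.mpr (Fin.pos k).ne'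
  have hkN : (k : ℕ) < N := k.isLt
  set c : ℕ := (k : ℕ) with hc
  have hg : ∀ x : ℕ, lapNNPinvFun K N (x : ℤ) (c : ℤ) =
      ((N : K) - 1) * (2 * N - 1) / (6 * N) + ((x : K) * (x + 1) + c * (c + 1)) / (2 * N) -
        x - (if x ≤ c then ((c : K) - x) else 0) := by
    intro x
    unfold lapNNPinvFun
    push_cast
    simp only [Int.ofNat_le]
    split_ifs <;> ring
  rw [Fin.sum_univ_eq_sum_range (fun x => lapNNPinvFun K N (x : ℤ) (c : ℤ)) N]
  simp only [hg, Finset.sum_sub_distrib, Finset.sum_add_distrib, Finset.sum_const,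
    Finset.card_range, nsmul_eq_mul, ← Finset.sum_div]
  have hfilter : (Finset.range N).filter (fun x => x ≤ c) = Finset.range (c + 1) := by
    ext x; simp only [Finset.mem_filter, Finset.mem_range]; omega
  rw [← Finset.sum_filter, hfilter, Finset.sum_sub_distrib, Finset.sum_const, Finset.card_range,
    nsmul_eq_mul]
  have hS1 := sum_range_natCast_mul_two (K := K) N
  have hS2 := sum_range_natCast_sq_mul_six (K := K) N
  have hT1 := sum_range_natCast_mul_two (K := K) (c + 1)
  have e1 : ∑ x ∈ Finset.range N, (x : K) * (x + 1) =
      (∑ x ∈ Finset.range N, (x : K) ^ 2) + (∑ x ∈ Finset.range N, (x : K)) := by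
    rw [← Finset.sum_add_distrib]
    exact Finset.sum_congr rfl fun x _ => by ring
  rw [e1]
  have eS1 : ∑ x ∈ Finset.range N, (x : K) = N * (N - 1) / 2 := by
    rw [eq_div_iff (by norm_num : (2 : K) ≠ 0)]; exact hS1
  have eS2 : ∑ x ∈ Finset.range N, (x : K) ^ 2 = N * (N - 1) * (2 * N - 1) / 6 := by
    rw [eq_div_iff (by norm_num : (6 : K) ≠ 0)]; exact hS2
  have eT1 : ∑ x ∈ Finset.range (c + 1), (x : K) = (c + 1 : ℕ) * ((c + 1 : ℕ) - 1 : K) / 2 := by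
    rw [eq_div_iff (by norm_num : (2 : K) ≠ 0)]; exact hT1
  rw [eS1, eS2, eT1]
  push_cast
  field_simp
  ring

variable (K) in
/-- `J (g_N(i,j))_{ij} = 0`.  [cite: PlonkaHoffmannWeickert2016, Thm. 2.5 (proof)] -/
theorem ones_mul_lapNNPinv (N : ℕ) : ones K (Fin N) * lapNNPinv K N = 0 := by
  ext i k
  rw [ones_mul_apply, Matrix.zero_apply]
  simp only [Matrix.vecMul, dotProduct, Pi.one_apply, one_mul, lapNNPinv, Matrix.of_apply]
  exact sum_lapNNPinvFun k


/-! ### L. THEOREM 2.6 of [PHW16]: the pseudoinverse of the Neumann biharmonic operator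
`L = −B² = −Δ_NN²` -/

variable (K) in
/-- The kernel of THEOREM 2.6 of [PHW16] (negated, `h_N = −d⁺`, since `(−B²)⁺ = −(Δ_NN²)⁺`),
written symmetrically as a function of two integers: with `a = i(i+1)`, `b = j(j+1)`,
`m = max(i,j)`, `n = min(i,j)`,
`h_N(i,j) = (N²−1)(4N²−1)/(180N) − (a+b)²/(24N) − ab/(6N) − N(a+b)/6 + (2m+1)(a_m + 3a_n)/12`.
[cite: PlonkaHoffmannWeickert2016, Thm. 2.6] -/
def biLapNNPinvFun (N : ℕ) (i j : ℤ) : K :=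
  ((N : K) ^ 2 - 1) * (4 * (N : K) ^ 2 - 1) / (180 * N) -
    ((i : K) * (i + 1) + j * (j + 1)) ^ 2 / (24 * N) - (i : K) * (i + 1) * (j * (j + 1)) / (6 * N) -
    N * ((i : K) * (i + 1) + j * (j + 1)) / 6 +
    (if i ≤ j then (2 * (j : K) + 1) * (j * (j + 1) + 3 * (i * (i + 1)))
      else (2 * (i : K) + 1) * (i * (i + 1) + 3 * (j * (j + 1)))) / 12

variable (K) in
/-- The matrix `(h_N(i, j))_{i,j<N}` — by Theorem 2.6 the pseudoinverse of `Δ_NN²`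
(`pinv_laplaceNN_sq`).  [cite: PlonkaHoffmannWeickert2016, Thm. 2.6] -/
def biLapNNPinv (N : ℕ) : Matrix (Fin N) (Fin N) K :=
  Matrix.of fun i j => biLapNNPinvFun K N ((i : ℕ) : ℤ) ((j : ℕ) : ℤ)

/-- `h_N` is symmetric.  [cite: PlonkaHoffmannWeickert2016, Thm. 2.6] -/
theorem biLapNNPinvFun_comm (N : ℕ) (i j : ℤ) :
    biLapNNPinvFun K N i j = biLapNNPinvFun K N j i := by
  unfold biLapNNPinvFun
  rcases lt_trichotomy i j with h | rfl | h
  · rw [if_pos h.le, if_neg (not_le.mpr h)]; ring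
  · rfl
  · rw [if_neg (not_le.mpr h), if_pos h.le]; ring

variable (K) in
/-- "`L⁺ = −(B²)⁺` is a symmetric matrix".  [cite: PlonkaHoffmannWeickert2016, Thm. 2.6] -/
theorem transpose_biLapNNPinv (N : ℕ) : (biLapNNPinv K N)ᵀ = biLapNNPinv K N := by
  ext i j
  simp only [Matrix.transpose_apply, biLapNNPinv, Matrix.of_apply]
  exact biLapNNPinvFun_comm N _ _

/-- The free three-point stencil of `h_N(·, k)` is `g_N(·, k)`:
`2h(i,k) − h(i−1,k) − h(i+1,k) = g(i,k)` for all integers `i, k`.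
[cite: PlonkaHoffmannWeickert2016, Thm. 2.6 (proof)] -/
theorem biLapNNPinvFun_stencil {N : ℕ} (hN : (N : K) ≠ 0) (i k : ℤ) :
    2 * biLapNNPinvFun K N i k - biLapNNPinvFun K N (i - 1) k - biLapNNPinvFun K N (i + 1) k =
      lapNNPinvFun K N i k := by
  unfold biLapNNPinvFun lapNNPinvFun
  rcases lt_trichotomy i k with h | rfl | h
  · rw [if_pos h.le, if_pos (by omega : i - 1 ≤ k), if_pos (by omega : i + 1 ≤ k), if_pos h.le]
    push_cast; field_simp; ring
  · rw [if_pos le_rfl, if_pos (by omega : i - 1 ≤ i), if_neg (by omega : ¬ i + 1 ≤ i),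
      if_pos le_rfl]
    push_cast; field_simp; ring
  · rw [if_neg (not_le.mpr h), if_neg (by omega : ¬ i + 1 ≤ k), if_neg (not_le.mpr h)]
    by_cases h1 : i - 1 ≤ k
    · rw [if_pos h1]; obtain rfl : i = k + 1 := by omega
      push_cast; field_simp; ring
    · rw [if_neg h1]; push_cast; field_simp; ring

/-- Reflection at the left end: `h_N(−1, k) = h_N(0, k)` for `k ≥ 0`.
[cite: PlonkaHoffmannWeickert2016, Thm. 2.6 (proof)] -/
theorem biLapNNPinvFun_neg_one (N : ℕ) {k : ℤ} (hk : 0 ≤ k) :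
    biLapNNPinvFun K N (-1) k = biLapNNPinvFun K N 0 k := by
  unfold biLapNNPinvFun
  rw [if_pos (by omega : (-1 : ℤ) ≤ k), if_pos hk]; push_cast; ring

/-- Reflection at the right end: `h_N(N, k) = h_N(N − 1, k)` for `k < N`.
[cite: PlonkaHoffmannWeickert2016, Thm. 2.6 (proof)] -/
theorem biLapNNPinvFun_natCast {N : ℕ} (hN : (N : K) ≠ 0) {k : ℤ} (hk : k < N) :
    biLapNNPinvFun K N N k = biLapNNPinvFun K N ((N : ℤ) - 1) k := by
  unfold biLapNNPinvFun
  rw [if_neg (by omega : ¬ (N : ℤ) ≤ k)]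
  by_cases h : (N : ℤ) - 1 ≤ k
  · rw [if_pos h]; obtain rfl : k = N - 1 := by omega
    push_cast; field_simp; ring
  · rw [if_neg h]; push_cast; field_simp; ring

variable (K) in
/-- `Δ_NN (h_N(i,j))_{ij} = (g_N(i,j))_{ij}`, i.e. `B (B²)⁺ = B⁺`.
[cite: PlonkaHoffmannWeickert2016, Thm. 2.6 (proof)] -/
theorem laplaceNN_mul_biLapNNPinv (N : ℕ) :
    laplaceNN K N * biLapNNPinv K N = lapNNPinv K N := by
  ext i k
  have hN : (N : K) ≠ 0 := Nat.cast_ne_zero.mpr (Fin.pos i).ne'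
  rw [Matrix.mul_apply]
  simp only [biLapNNPinv, lapNNPinv, Matrix.of_apply]
  rw [sum_laplaceNN_mul i (fun x => biLapNNPinvFun K N x ((k : ℕ) : ℤ))]
  have h1 : (if (i : ℕ) = 0 then biLapNNPinvFun K N ((i : ℕ) : ℤ) ((k : ℕ) : ℤ)
      else biLapNNPinvFun K N (((i : ℕ) : ℤ) - 1) ((k : ℕ) : ℤ)) =
        biLapNNPinvFun K N (((i : ℕ) : ℤ) - 1) ((k : ℕ) : ℤ) := by
    split_ifs with h0
    · rw [h0]; exact (biLapNNPinvFun_neg_one N (by omega)).symm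
    · rfl
  have h2 : (if (i : ℕ) + 1 = N then biLapNNPinvFun K N ((i : ℕ) : ℤ) ((k : ℕ) : ℤ)
      else biLapNNPinvFun K N (((i : ℕ) : ℤ) + 1) ((k : ℕ) : ℤ)) =
        biLapNNPinvFun K N (((i : ℕ) : ℤ) + 1) ((k : ℕ) : ℤ) := by
    split_ifs with h0
    · have hi : ((i : ℕ) : ℤ) = (N : ℤ) - 1 := by omega
      rw [hi, sub_add_cancel]
      exact (biLapNNPinvFun_natCast hN (by have := k.isLt; omega)).symm
    · rfl
  rw [h1, h2, biLapNNPinvFun_stencil hN]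

variable (K) in
/-- `(g_N(i,j))_{ij} Δ_NN = I − J/N` (transpose of `laplaceNN_mul_lapNNPinv`).
[cite: PlonkaHoffmannWeickert2016, Thm. 2.5, Thm. 2.1 (proof)] -/
theorem lapNNPinv_mul_laplaceNN (N : ℕ) :
    lapNNPinv K N * laplaceNN K N = 1 - (N : K)⁻¹ • ones K (Fin N) := by
  have h := congrArg Matrix.transpose (laplaceNN_mul_lapNNPinv K N)
  rwa [Matrix.transpose_mul, transpose_laplaceNN, transpose_lapNNPinv, Matrix.transpose_sub,
    Matrix.transpose_one, Matrix.transpose_smul, transpose_ones] at h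

/-- The zeroth column sum of `(h_N(i,j))` vanishes: `Σ_{x<N} h_N(x, 0) = 0` (power sums up to
`Σ x⁴`).  [cite: PlonkaHoffmannWeickert2016, Thm. 2.6 (proof)] -/
theorem sum_biLapNNPinvFun_zero {N : ℕ} (hN : (N : K) ≠ 0) :
    ∑ x ∈ Finset.range N, biLapNNPinvFun K N (x : ℤ) 0 = 0 := by
  have hx : ∀ x : ℕ, biLapNNPinvFun K N (x : ℤ) 0 =
      ((N : K) ^ 2 - 1) * (4 * (N : K) ^ 2 - 1) / (180 * N) -
        (24 * (N : K))⁻¹ * (x : K) ^ 4 + (6⁻¹ - (12 * (N : K))⁻¹) * (x : K) ^ 3 +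
        (4⁻¹ - (24 * (N : K))⁻¹ - N / 6) * (x : K) ^ 2 + (12⁻¹ - (N : K) / 6) * x := by
    intro x
    unfold biLapNNPinvFun
    push_cast
    split_ifs with h
    · obtain rfl : x = 0 := by omega
      push_cast; field_simp; ring
    · field_simp; ring
  rw [Finset.sum_congr rfl fun x _ => hx x]
  simp only [Finset.sum_add_distrib, Finset.sum_sub_distrib, ← Finset.mul_sum, Finset.sum_const,
    Finset.card_range, nsmul_eq_mul]
  have h1 := sum_range_natCast_mul_two (K := K) N
  have h2 := sum_range_natCast_sq_mul_six (K := K) N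
  have h3 := sum_range_natCast_cube_mul_four (K := K) N
  have h4 := sum_range_natCast_fourth_mul_thirty (K := K) N
  have e1 : ∑ x ∈ Finset.range N, (x : K) = N * (N - 1) / 2 := by
    rw [eq_div_iff (by norm_num : (2 : K) ≠ 0)]; exact h1
  have e2 : ∑ x ∈ Finset.range N, (x : K) ^ 2 = N * (N - 1) * (2 * N - 1) / 6 := by
    rw [eq_div_iff (by norm_num : (6 : K) ≠ 0)]; exact h2
  have e3 : ∑ x ∈ Finset.range N, (x : K) ^ 3 = (N : K) ^ 2 * (N - 1) ^ 2 / 4 := by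
    rw [eq_div_iff (by norm_num : (4 : K) ≠ 0)]; exact h3
  have e4 : ∑ x ∈ Finset.range N, (x : K) ^ 4 =
      N * (N - 1) * (2 * N - 1) * (3 * (N : K) ^ 2 - 3 * N - 1) / 30 := by
    rw [eq_div_iff (by norm_num : (30 : K) ≠ 0)]; exact h4
  rw [e1, e2, e3, e4]
  field_simp
  ring

variable (K) in
/-- `J (h_N(i,j))_{ij} = 0`: all column sums of `(h_N)` vanish.  Mechanism: `G² = G(Δ H) =
(I − J/N) H = H − J H/N` with `G = Δ_NN⁺`, `H = (h_N)` both symmetric forces `J H` to be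
symmetric, i.e. all column sums of `H` are equal — and the zeroth one vanishes.
[cite: PlonkaHoffmannWeickert2016, Thm. 2.6 (proof)] -/
theorem ones_mul_biLapNNPinv (N : ℕ) : ones K (Fin N) * biLapNNPinv K N = 0 := by
  rcases Nat.eq_zero_or_pos N with rfl | hpos
  · ext i; exact Fin.elim0 i
  have hN : (N : K) ≠ 0 := Nat.cast_ne_zero.mpr hpos.ne'
  have hGG : lapNNPinv K N * lapNNPinv K N =
      biLapNNPinv K N - (N : K)⁻¹ • (ones K (Fin N) * biLapNNPinv K N) := by
    calc lapNNPinv K N * lapNNPinv K N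
        = lapNNPinv K N * (laplaceNN K N * biLapNNPinv K N) := by
          rw [laplaceNN_mul_biLapNNPinv]
      _ = (1 - (N : K)⁻¹ • ones K (Fin N)) * biLapNNPinv K N := by
          rw [← Matrix.mul_assoc, lapNNPinv_mul_laplaceNN]
      _ = biLapNNPinv K N - (N : K)⁻¹ • (ones K (Fin N) * biLapNNPinv K N) := by
          rw [sub_mul, one_mul, smul_mul_assoc]
  have hsymm : (ones K (Fin N) * biLapNNPinv K N)ᵀ = ones K (Fin N) * biLapNNPinv K N := by
    have h3 := congrArg Matrix.transpose hGG
    rw [Matrix.transpose_mul, transpose_lapNNPinv, hGG, Matrix.transpose_sub,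
      transpose_biLapNNPinv, Matrix.transpose_smul] at h3
    have h4 := sub_right_injective h3
    have h5 := congrArg (fun M : Matrix (Fin N) (Fin N) K => (N : K) • M) h4
    simp only [smul_smul, mul_inv_cancel₀ hN, one_smul] at h5
    exact h5.symm
  ext i k
  have hcol : (ones K (Fin N) * biLapNNPinv K N) i k =
      (ones K (Fin N) * biLapNNPinv K N) i ⟨0, hpos⟩ := by
    have h := congrFun (congrFun hsymm ⟨0, hpos⟩) k
    rw [Matrix.transpose_apply, ones_mul_apply, ones_mul_apply] at h
    rw [ones_mul_apply, ones_mul_apply]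
    exact h.symm
  rw [hcol, ones_mul_apply, Matrix.zero_apply]
  simp only [Matrix.vecMul, dotProduct, Pi.one_apply, one_mul, biLapNNPinv, Matrix.of_apply,
    Nat.cast_zero]
  rw [Fin.sum_univ_eq_sum_range (fun x => biLapNNPinvFun K N (x : ℤ) 0) N]
  exact sum_biLapNNPinvFun_zero hN

/-! #### The Penrose equations from `L X = I − J/N` (the mechanism of [PHW16, Thm. 2.1]) -/

/-- The mechanism of THEOREMS 2.1 / 2.5 of [PHW16]: if `L` and `X` are symmetric,
`L X = I − J/N`, `J X = 0` and `J L = 0`, then also `X L = I − J/N` and `X` satisfies the four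
Penrose equations for `L` ("`L L⁺ = L⁺ L = I − J/N`").
[cite: PlonkaHoffmannWeickert2016, Thm. 2.1 (proof)] -/
theorem isMoorePenroseInverse_of_mul_eq_one_sub {𝕜 : Type*} [RCLike 𝕜] {m : Type*} [Fintype m]
    [DecidableEq m] {L X : Matrix m m 𝕜} (N : ℕ) (hLt : Lᵀ = L) (hXt : Xᵀ = X)
    (hLX : L * X = 1 - (N : 𝕜)⁻¹ • ones 𝕜 m) (hJX : ones 𝕜 m * X = 0)
    (hJL : ones 𝕜 m * L = 0) :
    IsMoorePenroseInverse L X ∧ X * L = 1 - (N : 𝕜)⁻¹ • ones 𝕜 m := by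
  have hXL : X * L = 1 - (N : 𝕜)⁻¹ • ones 𝕜 m := by
    calc X * L = (L * X)ᵀ := by rw [Matrix.transpose_mul, hXt, hLt]
      _ = 1 - (N : 𝕜)⁻¹ • ones 𝕜 m := by
        rw [hLX, Matrix.transpose_sub, Matrix.transpose_one, Matrix.transpose_smul,
          transpose_ones]
  have hP := isHermitian_one_sub_inv_smul_ones 𝕜 m N
  refine ⟨⟨?_, ?_, ?_, ?_⟩, hXL⟩
  · rw [hLX, sub_mul, one_mul, smul_mul_assoc, hJL, smul_zero, sub_zero]
  · rw [hXL, sub_mul, one_mul, smul_mul_assoc, hJX, smul_zero, sub_zero]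
  · rw [hLX]; exact hP
  · rw [hXL]; exact hP

section RCLike

variable (𝕜 : Type*) [RCLike 𝕜]

/-- THEOREM 2.5 of [PHW16] (Penrose form): `(g_N(i,j))_{i,j<N}` satisfies the four Penrose
equations for the Neumann Laplacian `Δ_NN` (every `N`).
[cite: PlonkaHoffmannWeickert2016, Thm. 2.5] -/
theorem isMoorePenroseInverse_laplaceNN (N : ℕ) :
    IsMoorePenroseInverse (laplaceNN 𝕜 N) (lapNNPinv 𝕜 N) :=
  (isMoorePenroseInverse_of_mul_eq_one_sub N (transpose_laplaceNN 𝕜 N) (transpose_lapNNPinv 𝕜 N)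
    (laplaceNN_mul_lapNNPinv 𝕜 N) (ones_mul_lapNNPinv 𝕜 N) (ones_mul_laplaceNN 𝕜 N)).1

/-- THEOREM 2.5 of [PHW16], matrix form: `pinv Δ_NN = (g_N(i,j))_{i,j<N}`.
[cite: PlonkaHoffmannWeickert2016, Thm. 2.5] -/
theorem pinv_laplaceNN (N : ℕ) : pinv (laplaceNN 𝕜 N) = lapNNPinv 𝕜 N :=
  (isMoorePenroseInverse_iff_eq_pinv.mp (isMoorePenroseInverse_laplaceNN 𝕜 N)).symm

/-- THEOREM 2.5 of [PHW16], entrywise for `Δ_NN = −B`: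
`(Δ_NN⁺)_{ij} = (N−1)(2N−1)/(6N) + (i(i+1) + j(j+1))/(2N) − max(i, j)`.
[cite: PlonkaHoffmannWeickert2016, Thm. 2.5] -/
theorem pinv_laplaceNN_apply {N : ℕ} (i j : Fin N) :
    pinv (laplaceNN 𝕜 N) i j =
      ((N : 𝕜) - 1) * (2 * N - 1) / (6 * N) + ((i : 𝕜) * (i + 1) + j * (j + 1)) / (2 * N) -
        (if i ≤ j then (j : 𝕜) else i) := by
  rw [pinv_laplaceNN, lapNNPinv, Matrix.of_apply, lapNNPinvFun]
  push_cast
  have h : ((i : ℕ) : ℤ) ≤ ((j : ℕ) : ℤ) ↔ i ≤ j := by rw [Int.ofNat_le, Fin.le_iff_val_le_val]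
  simp only [h]

/-- THEOREM 2.5 of [PHW16], VERBATIM, for `B = −Δ_NN` ("`b⁺_{j,k} = −(N−1)(2N−1)/(6N) + j
− j(j+1)/(2N) − k(k+1)/(2N)` for `j ≥ k`"; `B⁺` is symmetric, `transpose_lapNNPinv`).
[cite: PlonkaHoffmannWeickert2016, Thm. 2.5] -/
theorem pinv_neg_laplaceNN_apply {N : ℕ} {j k : Fin N} (hkj : k ≤ j) :
    pinv (-laplaceNN 𝕜 N) j k =
      -(((N : 𝕜) - 1) * (2 * N - 1) / (6 * N)) + j - (j : 𝕜) * (j + 1) / (2 * N) -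
        (k : 𝕜) * (k + 1) / (2 * N) := by
  rw [pinv_neg, Matrix.neg_apply, pinv_laplaceNN_apply]
  rcases hkj.lt_or_eq with h | h
  · rw [if_neg (not_le.mpr h)]; ring
  · rw [h, if_pos le_rfl]; ring

/-- `Δ_NN Δ_NN⁺ = I − J/N`.  [cite: PlonkaHoffmannWeickert2016, Thm. 2.5, Thm. 2.1 (proof)] -/
theorem laplaceNN_mul_pinv (N : ℕ) :
    laplaceNN 𝕜 N * pinv (laplaceNN 𝕜 N) = 1 - (N : 𝕜)⁻¹ • ones 𝕜 (Fin N) := by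
  rw [pinv_laplaceNN, laplaceNN_mul_lapNNPinv]

/-- `Δ_NN⁺ Δ_NN = I − J/N`.  [cite: PlonkaHoffmannWeickert2016, Thm. 2.5, Thm. 2.1 (proof)] -/
theorem pinv_mul_laplaceNN (N : ℕ) :
    pinv (laplaceNN 𝕜 N) * laplaceNN 𝕜 N = 1 - (N : 𝕜)⁻¹ • ones 𝕜 (Fin N) := by
  rw [pinv_laplaceNN]
  exact (isMoorePenroseInverse_of_mul_eq_one_sub N (transpose_laplaceNN 𝕜 N)
    (transpose_lapNNPinv 𝕜 N) (laplaceNN_mul_lapNNPinv 𝕜 N) (ones_mul_lapNNPinv 𝕜 N)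
    (ones_mul_laplaceNN 𝕜 N)).2

/-- The discrete Neumann problem: for mean-zero data `g`, `u = Δ_NN⁺ g` solves `Δ_NN u = g`.
[cite: PlonkaHoffmannWeickert2016, Thm. 2.5, Thm. 2.1 (proof)] -/
theorem laplaceNN_mulVec_pinv_mulVec {N : ℕ} {g : Fin N → 𝕜} (hg : ∑ j, g j = 0) :
    laplaceNN 𝕜 N *ᵥ (pinv (laplaceNN 𝕜 N) *ᵥ g) = g := by
  rw [Matrix.mulVec_mulVec, laplaceNN_mul_pinv, Matrix.sub_mulVec, Matrix.one_mulVec,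
    Matrix.smul_mulVec, ones_mulVec, hg]
  ext i; simp

/-- `(Δ_NN⁺)² = (h_N(i,j))_{ij}` ("`(B²)⁺ = (B⁺)²`" made explicit).
[cite: PlonkaHoffmannWeickert2016, Thm. 2.6 (proof)] -/
theorem pinv_laplaceNN_mul_self (N : ℕ) :
    pinv (laplaceNN 𝕜 N) * pinv (laplaceNN 𝕜 N) = biLapNNPinv 𝕜 N := by
  calc pinv (laplaceNN 𝕜 N) * pinv (laplaceNN 𝕜 N)
      = pinv (laplaceNN 𝕜 N) * (laplaceNN 𝕜 N * biLapNNPinv 𝕜 N) := by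
        rw [laplaceNN_mul_biLapNNPinv, pinv_laplaceNN]
    _ = (1 - (N : 𝕜)⁻¹ • ones 𝕜 (Fin N)) * biLapNNPinv 𝕜 N := by
        rw [← Matrix.mul_assoc, pinv_mul_laplaceNN]
    _ = biLapNNPinv 𝕜 N := by
        rw [sub_mul, one_mul, smul_mul_assoc, ones_mul_biLapNNPinv, smul_zero, sub_zero]

/-- THEOREM 2.6 of [PHW16] (Penrose form): `(h_N(i,j))_{ij}` satisfies the four Penrose
equations for `Δ_NN² = B²`.  [cite: PlonkaHoffmannWeickert2016, Thm. 2.6] -/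
theorem isMoorePenroseInverse_laplaceNN_sq (N : ℕ) :
    IsMoorePenroseInverse (laplaceNN 𝕜 N * laplaceNN 𝕜 N) (biLapNNPinv 𝕜 N) := by
  have h := isMoorePenroseInverse_mul_self_of_commute (isMoorePenroseInverse_laplaceNN 𝕜 N)
    (by rw [laplaceNN_mul_lapNNPinv, lapNNPinv_mul_laplaceNN])
  have e : lapNNPinv 𝕜 N * lapNNPinv 𝕜 N = biLapNNPinv 𝕜 N := by
    rw [← pinv_laplaceNN]; exact pinv_laplaceNN_mul_self 𝕜 N
  rwa [e] at h

/-- THEOREM 2.6 of [PHW16], matrix form: `pinv (Δ_NN²) = (h_N(i,j))_{i,j<N}`.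
[cite: PlonkaHoffmannWeickert2016, Thm. 2.6] -/
theorem pinv_laplaceNN_sq (N : ℕ) :
    pinv (laplaceNN 𝕜 N * laplaceNN 𝕜 N) = biLapNNPinv 𝕜 N :=
  (isMoorePenroseInverse_iff_eq_pinv.mp (isMoorePenroseInverse_laplaceNN_sq 𝕜 N)).symm

/-- THEOREM 2.6 of [PHW16], VERBATIM, for the biharmonic operator `L = −B² = −Δ_NN²` with
reflecting boundary conditions: "`L⁺ = −(B²)⁺ = (d⁺_{j,k})` with `d⁺_{j,k} =
−(N²−1)(4N²−1)/(180N) + [j(j+1)+k(k+1)]²/(24N) + j(j+1)k(k+1)/(6N) + (N/6)[j(j+1)+k(k+1)]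
− ((2j+1)/12)[j(j+1)+3k(k+1)]` for `j ≥ k`".  [cite: PlonkaHoffmannWeickert2016, Thm. 2.6] -/
theorem pinv_neg_laplaceNN_sq_apply {N : ℕ} {j k : Fin N} (hkj : k ≤ j) :
    pinv (-(laplaceNN 𝕜 N * laplaceNN 𝕜 N)) j k =
      -(((N : 𝕜) ^ 2 - 1) * (4 * (N : 𝕜) ^ 2 - 1) / (180 * N)) +
        ((j : 𝕜) * (j + 1) + k * (k + 1)) ^ 2 / (24 * N) +
        (j : 𝕜) * (j + 1) * (k * (k + 1)) / (6 * N) + N * ((j : 𝕜) * (j + 1) + k * (k + 1)) / 6 -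
        (2 * (j : 𝕜) + 1) * (j * (j + 1) + 3 * (k * (k + 1))) / 12 := by
  rw [pinv_neg, Matrix.neg_apply, pinv_laplaceNN_sq, biLapNNPinv, Matrix.of_apply, biLapNNPinvFun]
  push_cast
  have h : ((j : ℕ) : ℤ) ≤ ((k : ℕ) : ℤ) ↔ j ≤ k := by rw [Int.ofNat_le, Fin.le_iff_val_le_val]
  simp only [h]
  rcases hkj.lt_or_eq with hlt | heq
  · rw [if_neg (not_le.mpr hlt)]; ring
  · rw [heq, if_pos le_rfl]; ring

end RCLike

end NeumannLaplacian

end Literature.LinearAlgebra.TensorNetworks
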